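import Literature.Analysis.FluidPDE.KatoDualityHeatTestTools
import Literature.Analysis.FluidPDE.LerayHopfMild
import Literature.Analysis.FluidPDE.NSSliceTimePairing
import Literature.Analysis.FluidPDE.SelfSimilar
import HarnessLib

/-!
# Distributional solutions with `L³` slices are mild solutions (Fabes–Jones–Rivière, (i) ⇒ (ii))

Analysis/FluidPDE proofs file (theorems only: no definitions, no named facts). The tree proves
that *classical* solutions with `L³` slices satisfy the duality (mild) identity
(`ClassicalL3Mild.lean`, `isMildNSSolutionFrom_of_memLp_three`) and, conversely, that Kato's mild
solutions are distributional solutions on the open slab (`kato_distributional_slab`). This file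
proves the implication **distributional ⇒ mild** for solutions with continuous `L³` slices:
let `(u, Π)` be a distributional (pressure-explicit) solution of the unforced Navier–Stokes
system (`ν > 0`) on the open slab `(0, S) × E` (`IsDistributionalNSSolutionOn`), with
`u ∈ C((0,S); L³)`, `sup_{0<τ<S} ‖u(τ)‖_{L³} < ∞` and `Π ∈ L^{3/2}((0,S) × E)`; then for all
`0 < s ≤ t < S` the two-time duality identity of Fabes–Jones–Rivière holds
(`IsMildNSSolutionBetween ν 0 u s t`):
`∫⟪u(t), φ⟫ = ∫⟪u(s), e^{ν(t−s)Δ}φ⟫ + ∫ₛᵗ ∫⟪u, (u·∇)e^{ν(t−τ)Δ}φ⟫ dτ` for every smooth compactly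
supported divergence-free `φ` (Fabes–Jones–Rivière 1972, Thm. 2.1, (i) ⇒ (ii); Lemarié-Rieusset
2002, Thm. 11.2 / 2016, Prop. 6.5 with Thm. 6.1). Combined with the tree's
`isDistributionalNSSolutionOn_slab_of_veryWeak` (very weak `L³` solutions with the Riesz pressure
are distributional) this is the classical statement "very weak solutions in `C_t L³` are mild
(Oseen) solutions", the entrance to Kato's theory (`kato_unique_holds`, `mild_L3_smooth_holds`).

## Proof

For `η ∈ C_c^∞((0, t))` and the cut-offs `χ_R = cutoff R`, the field
`ψ(τ, x) = η(τ) χ_R(x) e^{ν(t−τ)Δ}φ(x)` is a legitimate space–time test field on the slab (the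
caloric field is jointly smooth below `t`, and `η` vanishes near `τ ≥ t`); the distributional
identity tested with `ψ` — the pressure term is kept, `χ_R ψ` not being divergence free —, after
the cancellation of the `χ_R⟪u, Δe^{ν(t−τ)Δ}φ⟫` terms against the backward heat equation, reads
`∫∫ (η'(τ) χ_R⟪u, Ψ⟫ + η(τ)[χ_R⟪u, (u·∇)Ψ⟫ + cut-off terms]) = 0`, `Ψ(τ) = e^{ν(t−τ)Δ}φ`
(`setIntegral_caloricCutoffTest_eq_zero`). As `R → ∞` the cut-off terms vanish by dominated
convergence on the slab (dominator `A‖u‖³ + B|Π|^{3/2} + C(‖Ψ‖ + ‖DΨ‖)`, from Young's inequality,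
exactly as in `ClassicalL3Mild`), whence by Fubini `∫ (η' g + η N) dτ = 0` with
`g(τ) = ∫⟪u(τ), Ψ(τ)⟫`, `N(τ) = ∫⟪u(τ), (u(τ)·∇)Ψ(τ)⟫` (`integral_deriv_mul_pairing_add_eq_zero`).
The du Bois-Reymond lemma (`exists_ae_eq_const_add_primitive`) gives `g = c + ∫₀ N` a.e. on
`(0, t)`; `g` is continuous on `(0, t]` (continuity of `u` in `L³`, and of `τ ↦ Ψ(τ)` in `L^{3/2}`
by interpolation between the `L¹` bound and the `L²`-Lipschitz bound `eLpNorm_heatTest_sub_le`),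
so `g(t) − g(s) = ∫ₛᵗ N`, which is the identity.

## References

* E. B. Fabes, B. F. Jones, N. M. Rivière, *The initial value problem for the Navier–Stokes
  equations with data in `L^p`*, Arch. Rational Mech. Anal. 45 (1972) 222–240, Thm. 2.1.
  [FabesJonesRiviere1972]
* P. G. Lemarié-Rieusset, *The Navier–Stokes Problem in the 21st Century*, CRC Press 2016,
  Prop. 6.5, Thm. 6.1, Def. 6.9 (pp. 130–136). [LemarieRieusset2016]
-/

noncomputable section

open MeasureTheory TopologicalSpace Set Function Filter Topology InnerProductSpace Metric
open scoped RealInnerProductSpace ENNReal NNReal Laplacian ContDiff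

namespace Literature.Analysis.FluidPDE

namespace DistributionalL3Mild

/-! ### Elementary inequalities -/

/-- `a²b ≤ (2a³ + b³)/3` for `a, b ≥ 0`. [folklore] -/
theorem sq_mul_le {a b : ℝ} (ha : 0 ≤ a) (hb : 0 ≤ b) :
    a ^ 2 * b ≤ 2 / 3 * a ^ 3 + 1 / 3 * b ^ 3 := by
  nlinarith [mul_nonneg (sq_nonneg (a - b)) (by positivity : (0 : ℝ) ≤ 2 * a + b)]

/-- `ab ≤ a³/3 + (2/3) c b` for `a, b ≥ 0`, `b ≤ c`, `1 ≤ c` (so that `b ≤ c²`; with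
`s = √b ≤ c`: `a s² ≤ a³/3 + (2/3)s³ ≤ a³/3 + (2/3) c s²`). [folklore] -/
theorem mul_le_cube_add {a b c : ℝ} (ha : 0 ≤ a) (hb : 0 ≤ b) (hbc : b ≤ c) (hc : 1 ≤ c) :
    a * b ≤ a ^ 3 / 3 + 2 / 3 * c * b := by
  set s : ℝ := Real.sqrt b with hs
  have hs0 : 0 ≤ s := Real.sqrt_nonneg b
  have hsb : s ^ 2 = b := Real.sq_sqrt hb
  have hsc : s ≤ c := by
    have h1 : s ≤ Real.sqrt c := Real.sqrt_le_sqrt hbc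
    have h2 : Real.sqrt c ≤ c := by
      rw [Real.sqrt_le_left (by linarith)]
      nlinarith
    exact h1.trans h2
  have key : 0 ≤ (a - s) ^ 2 * (a + 2 * s) := mul_nonneg (sq_nonneg _) (by positivity)
  rw [← hsb]
  nlinarith [mul_nonneg hs0 hs0, mul_le_mul_of_nonneg_left hsc (mul_nonneg hs0 hs0)]

/-- `b³ ≤ C² b` for `0 ≤ b ≤ C`. [folklore] -/
theorem pow_three_le {b C : ℝ} (hb0 : 0 ≤ b) (hb : b ≤ C) : b ^ 3 ≤ C ^ 2 * b := by
  have hC : 0 ≤ C := hb0.trans hb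
  nlinarith [mul_le_mul hb hb hb0 hC, mul_nonneg hb0 hb0]

/-- Young's inequality `|Q| b ≤ (2/3)|Q|^{3/2} + b³/3` for `b ≥ 0`. [folklore] -/
theorem abs_mul_le_young {Q b : ℝ} (hb : 0 ≤ b) :
    |Q| * b ≤ 2 / 3 * |Q| ^ (3 / 2 : ℝ) + 1 / 3 * b ^ 3 := by
  have hpq : (3 / 2 : ℝ).HolderConjugate 3 := by
    rw [Real.holderConjugate_iff]
    norm_num
  have h := Real.young_inequality |Q| b hpq
  rw [abs_abs, abs_of_nonneg hb] at h
  have e : b ^ (3 : ℝ) = b ^ 3 := by exact_mod_cast Real.rpow_natCast b 3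
  rw [e] at h
  linarith

/-- `3/2 ≠ ∞` in `ℝ≥0∞` (local copy of `FunctionSpaces.ennreal_three_halves_ne_top`, to keep the
import closure small). [folklore] -/
private theorem three_halves_ne_top : (3 / 2 : ℝ≥0∞) ≠ ⊤ :=
  ENNReal.div_ne_top (by norm_num) (by norm_num)

/-- `1 ≤ 3/2` in `ℝ≥0∞` (local copy of `FunctionSpaces.ennreal_one_le_three_halves`). [folklore] -/
private theorem one_le_three_halves : (1 : ℝ≥0∞) ≤ 3 / 2 :=
  ((ENNReal.lt_div_iff_mul_lt (Or.inl (by norm_num)) (Or.inl (by norm_num))).2 (by norm_num)).le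

/-- `(3/2).toReal = 3/2` (local copy of `ennreal_toReal_three_halves`). [folklore] -/
private theorem toReal_three_halves : (3 / 2 : ℝ≥0∞).toReal = 3 / 2 := by
  rw [ENNReal.toReal_div]; norm_num

/-! ### Interpolation `L^{3/2} ⊆ (L¹, L²)` -/

section Interpolation

variable {α : Type*} [MeasurableSpace α] {μ : Measure α} {G : Type*} [NormedAddCommGroup G]

/-- `∫ ‖h‖^{3/2} ≤ (∫ ‖h‖)^{1/2} (∫ ‖h‖²)^{1/2}` (Cauchy–Schwarz for `‖h‖^{1/2} · ‖h‖`). [folklore] -/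
theorem lintegral_rpow_threeHalves_le {h : α → G} (hh : AEStronglyMeasurable h μ) :
    ∫⁻ x, ‖h x‖ₑ ^ (3 / 2 : ℝ) ∂μ ≤
      (∫⁻ x, ‖h x‖ₑ ∂μ) ^ (1 / 2 : ℝ) * (∫⁻ x, ‖h x‖ₑ ^ (2 : ℕ) ∂μ) ^ (1 / 2 : ℝ) := by
  have hpq : (2 : ℝ).HolderConjugate 2 := Real.holderConjugate_iff.2 ⟨by norm_num, by norm_num⟩
  have hm : AEMeasurable (fun x => ‖h x‖ₑ) μ := hh.enorm
  have key := ENNReal.lintegral_mul_le_Lp_mul_Lq μ hpq (hm.pow_const (1 / 2 : ℝ)) hm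
  have e1 : ∀ x, ‖h x‖ₑ ^ (1 / 2 : ℝ) * ‖h x‖ₑ = ‖h x‖ₑ ^ (3 / 2 : ℝ) := fun x => by
    conv_lhs => rw [← ENNReal.rpow_one (‖h x‖ₑ), ← ENNReal.rpow_mul,
      ← ENNReal.rpow_add_of_nonneg _ _ (by norm_num) (by norm_num)]
    norm_num
  have e2 : ∀ x, (‖h x‖ₑ ^ (1 / 2 : ℝ)) ^ (2 : ℝ) = ‖h x‖ₑ := fun x => by
    rw [← ENNReal.rpow_mul]; norm_num
  have e3 : ∀ x, ‖h x‖ₑ ^ (2 : ℝ) = ‖h x‖ₑ ^ (2 : ℕ) := fun x => by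
    exact_mod_cast ENNReal.rpow_natCast (‖h x‖ₑ) 2
  simp only [Pi.mul_apply, e1, e2, e3] at key
  exact key

/-- **`L^{3/2}` interpolation**: `‖h‖_{L^{3/2}} ≤ ‖h‖_{L¹}^{1/3} ‖h‖_{L²}^{2/3}`. [folklore] -/
theorem eLpNorm_threeHalves_le {h : α → G} (hh : AEStronglyMeasurable h μ) :
    eLpNorm h (3 / 2) μ ≤ eLpNorm h 1 μ ^ (1 / 3 : ℝ) * eLpNorm h 2 μ ^ (2 / 3 : ℝ) := by
  have h32 := lintegral_rpow_threeHalves_le (μ := μ) hh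
  rw [eLpNorm_eq_lintegral_rpow_enorm_toReal (by norm_num) three_halves_ne_top, toReal_three_halves,
    eLpNorm_one_eq_lintegral_enorm,
    eLpNorm_eq_lintegral_rpow_enorm_toReal two_ne_zero ENNReal.ofNat_ne_top, ENNReal.toReal_ofNat,
    show (1 : ℝ) / (3 / 2) = 2 / 3 by norm_num]
  have e3 : ∀ x, ‖h x‖ₑ ^ (2 : ℝ) = ‖h x‖ₑ ^ (2 : ℕ) := fun x => by
    exact_mod_cast ENNReal.rpow_natCast (‖h x‖ₑ) 2
  simp only [e3]
  calc (∫⁻ x, ‖h x‖ₑ ^ (3 / 2 : ℝ) ∂μ) ^ (2 / 3 : ℝ)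
      ≤ ((∫⁻ x, ‖h x‖ₑ ∂μ) ^ (1 / 2 : ℝ) * (∫⁻ x, ‖h x‖ₑ ^ (2 : ℕ) ∂μ) ^ (1 / 2 : ℝ)) ^
          (2 / 3 : ℝ) := by
        gcongr
    _ = (∫⁻ x, ‖h x‖ₑ ∂μ) ^ (1 / 3 : ℝ) *
          ((∫⁻ x, ‖h x‖ₑ ^ (2 : ℕ) ∂μ) ^ (1 / 2 : ℝ)) ^ (2 / 3 : ℝ) := by
        rw [ENNReal.mul_rpow_of_nonneg _ _ (by norm_num)]
        congr 1
        rw [← ENNReal.rpow_mul]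
        norm_num

end Interpolation

/-! ### The caloric test field: `L^{3/2}`-continuity in time -/

section Caloric

variable {E : Type*} [NormedAddCommGroup E] [InnerProductSpace ℝ E] [FiniteDimensional ℝ E]
  [MeasurableSpace E] [BorelSpace E]

/-- **`L^{3/2}`-Hölder continuity in time of the caloric test field**: for a test field `φ`,
`0 < ν` and `σ₁ ≤ σ₂ ≤ t`,
`‖e^{ν(t−σ₂)Δ}φ − e^{ν(t−σ₁)Δ}φ‖_{3/2} ≤ (2‖φ‖₁)^{1/3} ((σ₂ − σ₁) ν ‖Δφ‖₂)^{2/3}`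
(interpolation between the `L¹` contraction and the `L²`-Lipschitz bound
`eLpNorm_heatTest_sub_le`). [folklore] -/
theorem eLpNorm_heatTest_sub_threeHalves_le {φ : E → E}
    (hφ : FunctionSpaces.IsTestFunctionOn (⊤ : Opens E) φ) {ν t σ₁ σ₂ : ℝ} (hν : 0 < ν)
    (h12 : σ₁ ≤ σ₂) (h2t : σ₂ ≤ t) :
    eLpNorm (heatTest ν φ (t - σ₂) - heatTest ν φ (t - σ₁)) (3 / 2) volume ≤
      (2 * eLpNorm φ 1 volume) ^ (1 / 3 : ℝ) *
        (ENNReal.ofReal (σ₂ - σ₁) * (ENNReal.ofReal ν * eLpNorm (Δ φ) 2 volume)) ^ (2 / 3 : ℝ) := by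
  have hφc : HasCompactSupport φ := hφ.hasCompactSupport
  have hφ2 : ContDiff ℝ 2 φ := contDiff_infty.1 hφ.contDiff 2
  have hφcont : Continuous φ := hφ.contDiff.continuous
  have hφ1 : MemLp φ 1 volume := hφcont.memLp_of_hasCompactSupport hφc
  have hΨ1 : ∀ σ, MemLp (heatTest ν φ (t - σ)) 1 volume := fun σ =>
    memLp_heatFlow_of_memLp hφ1 le_rfl _
  have hm : AEStronglyMeasurable (heatTest ν φ (t - σ₂) - heatTest ν φ (t - σ₁)) volume :=
    ((hΨ1 σ₂).sub (hΨ1 σ₁)).1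
  refine (eLpNorm_threeHalves_le hm).trans ?_
  gcongr
  · -- `L¹`: `‖Ψ₂ − Ψ₁‖₁ ≤ ‖Ψ₂‖₁ + ‖Ψ₁‖₁ ≤ 2‖φ‖₁`
    calc eLpNorm (heatTest ν φ (t - σ₂) - heatTest ν φ (t - σ₁)) 1 volume
        ≤ eLpNorm (heatTest ν φ (t - σ₂)) 1 volume + eLpNorm (heatTest ν φ (t - σ₁)) 1 volume :=
          eLpNorm_sub_le (hΨ1 σ₂).1 (hΨ1 σ₁).1 le_rfl
      _ ≤ eLpNorm φ 1 volume + eLpNorm φ 1 volume :=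
          add_le_add (eLpNorm_heatFlow_le_of_memLp hφ1 le_rfl _)
            (eLpNorm_heatFlow_le_of_memLp hφ1 le_rfl _)
      _ = 2 * eLpNorm φ 1 volume := by rw [two_mul]
  · exact eLpNorm_heatTest_sub_le hφ2 hφc hν h12 h2t

end Caloric

/-! ### The space–time test field `η(τ) χ(x) e^{ν(t−τ)Δ}φ(x)` -/

section TestField

variable {E : Type*} [NormedAddCommGroup E] [InnerProductSpace ℝ E] [FiniteDimensional ℝ E]
  [MeasurableSpace E] [BorelSpace E]

/-- Gluing: if `f` is `Cⁿ` with `tsupport f ⊆ O`, `O` open, and `g` is `Cⁿ` on `O`, then `f • g` is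
`Cⁿ` everywhere (copy of the tree's `contDiff_cutoff_smul_of_contDiffOn`, kept local to keep the
import closure small). [folklore] -/
theorem contDiff_smul_of_tsupport_subset {X : Type*} [NormedAddCommGroup X] [NormedSpace ℝ X]
    {F : Type*} [NormedAddCommGroup F] [NormedSpace ℝ F] {n : WithTop ℕ∞} {f : X → ℝ}
    {g : X → F} {O : Set X} (hO : IsOpen O) (hf : ContDiff ℝ n f) (hfO : tsupport f ⊆ O)
    (hg : ContDiffOn ℝ n g O) : ContDiff ℝ n fun z => f z • g z := by
  rw [contDiff_iff_contDiffAt]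
  intro z
  by_cases hz : z ∈ O
  · exact hf.contDiffAt.smul (hg.contDiffAt (hO.mem_nhds hz))
  · have hz' : z ∉ tsupport f := fun h => hz (hfO h)
    have h0 : (fun w => f w • g w) =ᶠ[𝓝 z] fun _ => 0 := by
      filter_upwards [notMem_tsupport_iff_eventuallyEq.1 hz'] with w hw
      simp [hw]
    exact contDiffAt_const.congr_of_eventuallyEq h0

variable {ν t : ℝ} {φ : E → E} {η : ℝ → ℝ} {χ : E → ℝ}

omit [InnerProductSpace ℝ E] [FiniteDimensional ℝ E] [MeasurableSpace E] [BorelSpace E] in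
/-- The scalar weight `(τ, x) ↦ η(τ) χ(x)` of a time bump and a space cut-off: smooth, with
topological support in `tsupport η ×ˢ tsupport χ`. [folklore] -/
theorem tsupport_weight_subset (η : ℝ → ℝ) (χ : E → ℝ) :
    tsupport (fun z : ℝ × E => η z.1 * χ z.2) ⊆ tsupport η ×ˢ tsupport χ := by
  refine closure_minimal (fun z hz => ?_) ((isClosed_tsupport η).prod (isClosed_tsupport χ))
  rw [mem_support, mul_ne_zero_iff] at hz
  exact ⟨subset_tsupport _ hz.1, subset_tsupport _ hz.2⟩

/-- **The cut-off caloric field is a space–time test field on the slab.** For a test field `φ`,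
`0 < ν`, `t < S`, a smooth time bump `η` with `tsupport η ⊆ (0, t)` and a smooth compactly
supported cut-off `χ`, the field `ψ(τ, x) = η(τ) • (χ(x) • e^{ν(t−τ)Δ}φ(x))` is smooth with
compact support in `(0, S) × E` (the caloric field is jointly smooth on `{τ < t}`, near which
`tsupport η` stays). [folklore] -/
theorem isSpaceTimeTestOn_caloricCutoffTest {S : ℝ} (hφ : FunctionSpaces.IsTestFunctionOn (⊤ : Opens E) φ)
    (hν : 0 < ν) (htS : t < S) (hη : ContDiff ℝ ∞ η) (hηc : HasCompactSupport η)
    (hηt : tsupport η ⊆ Ioo 0 t) (hχ : ContDiff ℝ ∞ χ) (hχc : HasCompactSupport χ) :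
    IsSpaceTimeTestOn (slab E (Ioo 0 S) isOpen_Ioo)
      (fun τ x => η τ • (χ x • heatTest ν φ (t - τ) x)) := by
  set f : ℝ × E → ℝ := fun z => η z.1 * χ z.2 with hf
  set g : ℝ × E → E := fun z => heatTest ν φ (t - z.1) z.2 with hg
  have hfs : ContDiff ℝ ∞ f := (hη.comp contDiff_fst).mul (hχ.comp contDiff_snd)
  have hft : tsupport f ⊆ tsupport η ×ˢ tsupport χ := tsupport_weight_subset η χ
  have hfc : HasCompactSupport f :=
    IsCompact.of_isClosed_subset (hηc.prod hχc) (isClosed_tsupport _) hft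
  have hfO : tsupport f ⊆ Iio t ×ˢ (univ : Set E) := fun z hz =>
    ⟨(hηt (hft hz).1).2, mem_univ _⟩
  have hgO : ContDiffOn ℝ ∞ g (Iio t ×ˢ (univ : Set E)) :=
    contDiffOn_uncurry_heatTest_sub hφ.contDiff.continuous.locallyIntegrable hφ.hasCompactSupport hν t
  have heq : (uncurry fun τ x => η τ • (χ x • heatTest ν φ (t - τ) x)) = fun z => f z • g z := by
    funext z
    simp only [uncurry, hf, hg, smul_smul]
  refine ⟨?_, ?_, ?_⟩
  · rw [heq]
    exact contDiff_smul_of_tsupport_subset (isOpen_Iio.prod isOpen_univ) hfs hfO hgO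
  · rw [heq]
    exact hfc.smul_right
  · rw [heq]
    refine (tsupport_smul_subset_left f g).trans (hft.trans fun z hz => ?_)
    rw [coe_slab]
    exact ⟨⟨(hηt hz.1).1, (hηt hz.1).2.trans htS⟩, mem_univ _⟩

/-- **Time derivative of the cut-off caloric test field**: with `Ψ(τ) = e^{ν(t−τ)Δ}φ`,
`∂_τ[η(τ) χ(x) Ψ(τ,x)] = η'(τ) χ(x) Ψ(τ,x) − ν η(τ) χ(x) (e^{ν(t−τ)Δ}Δφ)(x)` for every `τ`
(below `t` by the backward heat equation `hasDerivAt_heatTest_sub`; for `τ ≥ t` both sides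
vanish, `η` being zero near `τ`). [folklore] -/
theorem timeDeriv_caloricCutoffTest (hφ : FunctionSpaces.IsTestFunctionOn (⊤ : Opens E) φ) (hν : 0 < ν)
    (hη : ContDiff ℝ ∞ η) (hηt : tsupport η ⊆ Ioo 0 t) (χ : E → ℝ) (τ : ℝ) (x : E) :
    timeDeriv (fun τ x => η τ • (χ x • heatTest ν φ (t - τ) x)) τ x =
      (deriv η τ * χ x) • heatTest ν φ (t - τ) x -
        (ν * η τ * χ x) • heatFlow (Δ φ) (ν * (t - τ)) x := by
  rw [timeDeriv_apply]
  have hφ2 : ContDiff ℝ 2 φ := contDiff_infty.1 hφ.contDiff 2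
  have hηd : ∀ s, HasDerivAt η (deriv η s) s := fun s =>
    ((hη.differentiable (by simp)) s).hasDerivAt
  rcases lt_or_ge τ t with hτ | hτ
  · -- below `t`: product rule and the backward heat equation
    have h1 : HasDerivAt (fun s => χ x • heatTest ν φ (t - s) x)
        (χ x • -(ν • heatFlow (Δ φ) (ν * (t - τ)) x)) τ :=
      (hasDerivAt_heatTest_sub hφ2 hφ.hasCompactSupport hν hτ x).const_smul (χ x)
    have h2 : HasDerivAt (fun s => η s • (χ x • heatTest ν φ (t - s) x))
        (η τ • (χ x • -(ν • heatFlow (Δ φ) (ν * (t - τ)) x)) +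
          deriv η τ • (χ x • heatTest ν φ (t - τ) x)) τ := (hηd τ).smul h1
    rw [h2.deriv]
    module
  · -- at or above `t`: `η` vanishes near `τ`
    have hτ' : τ ∉ tsupport η := fun h => (not_lt.2 hτ) (hηt h).2
    have hη0 : η =ᶠ[𝓝 τ] fun _ => 0 := notMem_tsupport_iff_eventuallyEq.1 hτ'
    have hητ : η τ = 0 := hη0.self_of_nhds
    have hdη : deriv η τ = 0 := by rw [hη0.deriv_eq]; exact deriv_const τ 0
    have h0 : (fun s => η s • (χ x • heatTest ν φ (t - s) x)) =ᶠ[𝓝 τ] fun _ => (0 : E) := by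
      filter_upwards [hη0] with s hs
      rw [hs, zero_smul]
    rw [h0.deriv_eq, deriv_const, hητ, hdη]
    simp

/-- **The pointwise integrand.** With `Ψ(τ) = e^{ν(t−τ)Δ}φ` (divergence free) and
`ψ = η ⊗ (χ Ψ)`, at every `(τ, x)`:
`⟪u, ∂_τψ⟫ + ⟪u, (u·∇)ψ⟫ + ν⟪u, Δψ⟫ + Π div ψ
 = η'(τ) χ⟪u, Ψ⟫ + η(τ)[χ⟪u, (u·∇)Ψ⟫ + (Dχ·u)⟪u, Ψ⟫ + ν(2Σᵢ ∂ᵢχ⟪u, ∂ᵢΨ⟫ + Δχ⟪u, Ψ⟫) + Π Dχ·Ψ]`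
(the `χ⟪u, ΔΨ⟫` terms cancel against the backward heat equation; `div Ψ = 0`). [folklore] -/
theorem veryWeakIntegrand_caloricCutoffTest (hφ : FunctionSpaces.IsTestFunctionOn (⊤ : Opens E) φ)
    (hdiv : VectorCalculus.IsDivFree φ) (hν : 0 < ν) (hη : ContDiff ℝ ∞ η)
    (hηt : tsupport η ⊆ Ioo 0 t) (hχ : ContDiff ℝ ∞ χ) (u : ℝ → E → E) (P : ℝ → E → ℝ)
    (τ : ℝ) (x : E) :
    ⟪u τ x, timeDeriv (fun τ x => η τ • (χ x • heatTest ν φ (t - τ) x)) τ x⟫ +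
      ⟪u τ x, convect (u τ) (fun y => η τ • (χ y • heatTest ν φ (t - τ) y)) x⟫ +
      ν * ⟪u τ x, (Δ (fun y => η τ • (χ y • heatTest ν φ (t - τ) y))) x⟫ +
      P τ x * VectorCalculus.divergence (fun y => η τ • (χ y • heatTest ν φ (t - τ) y)) x =
    deriv η τ * (χ x * ⟪u τ x, heatTest ν φ (t - τ) x⟫) +
      η τ * (χ x * ⟪u τ x, convect (u τ) (heatTest ν φ (t - τ)) x⟫ +
        fderiv ℝ χ x (u τ x) * ⟪u τ x, heatTest ν φ (t - τ) x⟫ +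
        ν * (2 * ∑ i, fderiv ℝ χ x (stdOrthonormalBasis ℝ E i) *
          ⟪u τ x, fderiv ℝ (heatTest ν φ (t - τ)) x (stdOrthonormalBasis ℝ E i)⟫ +
          (Δ χ) x * ⟪u τ x, heatTest ν φ (t - τ) x⟫) +
        P τ x * fderiv ℝ χ x (heatTest ν φ (t - τ) x)) := by
  set b := stdOrthonormalBasis ℝ E with hb
  set Ψ : E → E := heatTest ν φ (t - τ) with hΨ
  have hφ2 : ContDiff ℝ 2 φ := contDiff_infty.1 hφ.contDiff 2
  have hφ1 : ContDiff ℝ 1 φ := contDiff_infty.1 hφ.contDiff 1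
  have hφc := hφ.hasCompactSupport
  have hΨ2 : ContDiff ℝ 2 Ψ := contDiff_heatFlow hφ2 hφc _
  have hΨ1 : ContDiff ℝ 1 Ψ := hΨ2.of_le one_le_two
  have hΨdiv : VectorCalculus.IsDivFree Ψ := isDivFree_heatFlow hφ1 hφc hdiv _
  have hχ2 : ContDiff ℝ 2 χ := hχ.of_le (by norm_cast)
  have hχ1 : ContDiff ℝ 1 χ := hχ.of_le (by norm_cast)
  have hχd : DifferentiableAt ℝ χ x := hχ1.differentiable one_ne_zero x
  have hΨd : DifferentiableAt ℝ Ψ x := hΨ1.differentiable one_ne_zero x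
  -- the inner field `w = χ • Ψ` and its calculus
  set w : E → E := fun y => χ y • Ψ y with hw
  have hw2 : ContDiff ℝ 2 w := hχ2.smul hΨ2
  have e1 : convect (u τ) w x = χ x • convect (u τ) Ψ x + (fderiv ℝ χ x (u τ x)) • Ψ x :=
    convect_smul_apply hχd hΨd
  have e2 : (Δ w) x = χ x • (Δ Ψ) x +
      (2 : ℝ) • ∑ i, (fderiv ℝ χ x (b i)) • fderiv ℝ Ψ x (b i) + ((Δ χ) x) • Ψ x :=
    laplacian_smul_apply hχ2 hΨ2 x
  have e3 : VectorCalculus.divergence w x = χ x * VectorCalculus.divergence Ψ x + ⟪Ψ x, gradient χ x⟫ :=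
    divergence_smul_apply hχd hΨd
  have e4 : ⟪Ψ x, gradient χ x⟫ = fderiv ℝ χ x (Ψ x) := by
    rw [gradient, real_inner_comm, InnerProductSpace.toDual_symm_apply]
  have hΔΨ : (Δ Ψ) x = heatFlow (Δ φ) (ν * (t - τ)) x := laplacian_heatFlow hφ2 hφc _ x
  -- the outer factor `η τ`
  have eψ : (fun y => η τ • (χ y • heatTest ν φ (t - τ) y)) = fun y => η τ • w y := rfl
  have c1 : convect (u τ) (fun y => η τ • w y) x = η τ • convect (u τ) w x := by
    simp only [convect]
    rw [show (fun y => η τ • w y) = η τ • w from rfl, fderiv_const_smul (hw2.differentiable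
      (by norm_num) x)]
    rfl
  have c2 : (Δ (fun y => η τ • w y)) x = η τ • (Δ w) x := by
    rw [show (fun y => η τ • w y) = η τ • w from rfl]
    exact InnerProductSpace.laplacian_smul (η τ) hw2.contDiffAt
  have c3 : VectorCalculus.divergence (fun y => η τ • w y) x = η τ * VectorCalculus.divergence w x := by
    have := divergence_smul_apply (θ := fun _ : E => η τ) (u := w) (x := x)
      (differentiableAt_const _) (hw2.differentiable (by norm_num) x)
    rw [this]
    have h0 : gradient (fun _ : E => η τ) x = 0 := by simp [gradient]
    rw [h0, inner_zero_right, add_zero]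
  rw [timeDeriv_caloricCutoffTest hφ hν hη hηt χ τ x, eψ, c1, c2, c3, e1, e2, e3, e4, hΨdiv x, hΔΨ]
  simp only [inner_add_right, inner_sub_right, real_inner_smul_right, inner_sum, smul_add,
    mul_zero, zero_add]
  ring

end TestField

/-! ### Measurability helpers -/

section Measurability

variable {α : Type*} [MeasurableSpace α] {μ : Measure α}
  {X : Type*} [NormedAddCommGroup X] [NormedSpace ℝ X]
  {Y : Type*} [NormedAddCommGroup Y] [NormedSpace ℝ Y]

/-- `a ↦ L(a)(v(a))` is a.e. strongly measurable for a.e. strongly measurable operator field `L`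
and vector field `v`. [folklore] -/
theorem aestronglyMeasurable_clm_apply {L : α → X →L[ℝ] Y} {v : α → X}
    (hL : AEStronglyMeasurable L μ) (hv : AEStronglyMeasurable v μ) :
    AEStronglyMeasurable (fun a => L a (v a)) μ := by
  have h := (ContinuousLinearMap.id ℝ (X →L[ℝ] Y)).aestronglyMeasurable_comp₂ hL hv
  simpa using h

end Measurability

/-! ### The tested identity `∫ (η' g + η N) dτ = 0` -/

section Core

variable {E : Type*} [NormedAddCommGroup E] [InnerProductSpace ℝ E] [FiniteDimensional ℝ E]
  [MeasurableSpace E] [BorelSpace E]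

variable {ν : ℝ} {u : ℝ → E → E} {P : ℝ → E → ℝ} {φ : E → E}

set_option maxHeartbeats 1600000 in
/-- **The tested identity.** Let `(u, P)` be a distributional solution of the unforced
Navier–Stokes system (`ν > 0`) on the slab `(0, S) × E` with `u(τ) ∈ L³`,
`‖u(τ)‖_{L³} ≤ M` for `τ ∈ (0, S)` and `P ∈ L^{3/2}((0,S) × E)`, let `φ` be a divergence-free
test field and `0 < t < S`. Then for every smooth `η` with compact support in `(0, t)`,
`∫₀ᵗ (η'(τ) ∫⟪u(τ), e^{ν(t−τ)Δ}φ⟫ + η(τ) ∫⟪u(τ), (u(τ)·∇)e^{ν(t−τ)Δ}φ⟫) dτ = 0`: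
the distributional identity tested with `η(τ) χ_R(x) e^{ν(t−τ)Δ}φ(x)` in the limit `R → ∞`
(dominated convergence on the slab), followed by Fubini.
[cite: FabesJonesRiviere1972, Thm. 2.1 (proof, (i) ⇒ (ii))] -/
theorem integral_deriv_mul_pairing_add_eq_zero {S t : ℝ} {M : ℝ≥0} (hν : 0 < ν)
    (hdist : IsDistributionalNSSolutionOn (slab E (Ioo 0 S) isOpen_Ioo) ν 0 u P)
    (hu3 : ∀ τ ∈ Ioo 0 S, MemLp (u τ) 3 volume)
    (huM : ∀ τ ∈ Ioo 0 S, eLpNorm (u τ) 3 volume ≤ M)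
    (hP : MemLp (uncurry P) (3 / 2) (volume.restrict (Ioo 0 S ×ˢ (univ : Set E))))
    (hφ : FunctionSpaces.IsTestFunctionOn (⊤ : Opens E) φ) (hdiv : VectorCalculus.IsDivFree φ)
    (ht : 0 < t) (htS : t < S) {η : ℝ → ℝ} (hη : ContDiff ℝ ∞ η) (hηc : HasCompactSupport η)
    (hηt : tsupport η ⊆ Ioo 0 t) :
    ∫ τ in Ioo 0 t, ((deriv η τ * ∫ x, ⟪u τ x, heatTest ν φ (t - τ) x⟫) +
      η τ * ∫ x, ⟪u τ x, convect (u τ) (heatTest ν φ (t - τ)) x⟫) = 0 := by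
  have hS : 0 < S := ht.trans htS
  set b := stdOrthonormalBasis ℝ E with hb
  -- ### the test field and its caloric companion
  have hφi : ContDiff ℝ ∞ φ := hφ.contDiff
  have hφ2 : ContDiff ℝ 2 φ := contDiff_infty.1 hφi 2
  have hφ1 : ContDiff ℝ 1 φ := contDiff_infty.1 hφi 1
  have hφc : HasCompactSupport φ := hφ.hasCompactSupport
  have hφc' : Continuous φ := hφi.continuous
  obtain ⟨Cφ, hCφ⟩ := hφc'.bounded_above_of_compact_support hφc
  have hCφ0 : 0 ≤ Cφ := (norm_nonneg _).trans (hCφ 0)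
  have hDφc : Continuous (fderiv ℝ φ) := hφ1.continuous_fderiv one_ne_zero
  have hDφs : HasCompactSupport (fderiv ℝ φ) := hφc.fderiv ℝ
  obtain ⟨CD, hCD⟩ := hDφc.bounded_above_of_compact_support hDφs
  have hCD0 : 0 ≤ CD := (norm_nonneg _).trans (hCD 0)
  have hφint : Integrable φ (volume : Measure E) := hφc'.integrable_of_hasCompactSupport hφc
  have hDφint : Integrable (fderiv ℝ φ) (volume : Measure E) :=
    hDφc.integrable_of_hasCompactSupport hDφs
  set Ψ : ℝ → E → E := fun τ => heatTest ν φ (t - τ) with hΨ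
  have hΨsm : ∀ τ, ContDiff ℝ 2 (Ψ τ) := fun τ => contDiff_heatFlow hφ2 hφc _
  have hΨ1 : ∀ τ, ContDiff ℝ 1 (Ψ τ) := fun τ => (hΨsm τ).of_le one_le_two
  have hΨcs : ∀ τ, Continuous (Ψ τ) := fun τ => (hΨsm τ).continuous
  have hDΨ : ∀ τ x, fderiv ℝ (Ψ τ) x = heatFlow (fderiv ℝ φ) (ν * (t - τ)) x := fun τ x =>
    fderiv_heatFlow hφ1 hφc _ x
  have hΨc : Continuous (uncurry Ψ) := continuous_uncurry_heatTest_sub hφc' hCφ ν t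
  have hDΨc : Continuous fun q : ℝ × E => fderiv ℝ (Ψ q.1) q.2 := by
    simp only [hDΨ]
    exact continuous_uncurry_heatTest_sub hDφc hCD ν t
  have hDΨcs : ∀ τ, Continuous fun x => fderiv ℝ (Ψ τ) x := fun τ =>
    hDΨc.comp (Continuous.prodMk_right τ)
  have hΨint : ∀ τ, Integrable (Ψ τ) (volume : Measure E) := fun τ => integrable_heatFlow hφint _
  have hDΨint : ∀ τ, Integrable (fun x => fderiv ℝ (Ψ τ) x) (volume : Measure E) := fun τ => by
    simp only [hDΨ]
    exact integrable_heatFlow hDφint _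
  have hΨL1 : ∀ τ, ∫ x, ‖Ψ τ x‖ ≤ ∫ x, ‖φ x‖ := fun τ => integral_norm_heatFlow_le hφint _
  have hDΨL1 : ∀ τ, ∫ x, ‖fderiv ℝ (Ψ τ) x‖ ≤ ∫ x, ‖fderiv ℝ φ x‖ := fun τ => by
    simp only [hDΨ]
    exact integral_norm_heatFlow_le hDφint _
  -- a common bound `C⋆ ≥ 1` for `Ψ` and `DΨ`
  set Cs : ℝ := max 1 (max Cφ CD) with hCs
  have hCs1 : 1 ≤ Cs := le_max_left _ _
  have hCs0 : 0 ≤ Cs := zero_le_one.trans hCs1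
  have hΨb : ∀ τ x, ‖Ψ τ x‖ ≤ Cs := fun τ x =>
    (norm_heatFlow_le hCφ _ x).trans ((le_max_left _ _).trans (le_max_right _ _))
  have hDΨb : ∀ τ x, ‖fderiv ℝ (Ψ τ) x‖ ≤ Cs := fun τ x => by
    rw [hDΨ]
    exact (norm_heatFlow_le hCD _ x).trans ((le_max_right _ _).trans (le_max_right _ _))
  -- ### the time bump
  obtain ⟨Mη, hMη⟩ := hη.continuous.bounded_above_of_compact_support hηc
  have hMη0 : 0 ≤ Mη := (norm_nonneg _).trans (hMη 0)
  have hηd : Continuous (deriv η) := hη.continuous_deriv (by simp)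
  obtain ⟨Md, hMd⟩ := hηd.bounded_above_of_compact_support hηc.deriv
  have hMd0 : 0 ≤ Md := (norm_nonneg _).trans (hMd 0)
  have hη0 : ∀ τ, τ ∉ tsupport η → η τ = 0 := fun τ hτ => image_eq_zero_of_notMem_tsupport hτ
  have hdη0 : ∀ τ, τ ∉ tsupport η → deriv η τ = 0 := fun τ hτ => by
    by_contra h'
    exact hτ (support_deriv_subset (mem_support.2 h'))
  -- ### cut-off constants
  obtain ⟨C₁, hC₁0, hC₁⟩ := exists_norm_fderiv_cutoff_le (E := E)
  obtain ⟨C₂, hC₂0, hC₂⟩ := exists_abs_laplacian_cutoff_le (E := E)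
  have hR : ∀ n : ℕ, (0 : ℝ) < n + 1 := fun n => by positivity
  have hR1 : ∀ n : ℕ, (1 : ℝ) ≤ n + 1 := fun n => by
    have : (0 : ℝ) ≤ n := n.cast_nonneg
    linarith
  have hDχ : ∀ (n : ℕ) (x : E), ‖fderiv ℝ (cutoff ((n : ℝ) + 1)) x‖ ≤ C₁ := fun n x =>
    (hC₁ _ (hR n) x).trans (div_le_self hC₁0 (hR1 n))
  have hΔχ : ∀ (n : ℕ) (x : E), |(Δ (cutoff ((n : ℝ) + 1) : E → ℝ)) x| ≤ C₂ := fun n x =>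
    (hC₂ _ (hR n) x).trans (div_le_self hC₂0 (by nlinarith [hR1 n]))
  -- ### the slab measure and the data on it
  set μS : Measure (ℝ × E) := (volume : Measure (ℝ × E)).restrict (Ioo 0 S ×ˢ univ) with hμS
  have hμS' : μS = (volume.restrict (Ioo 0 S)).prod (volume : Measure E) :=
    volume_restrict_prod_univ_eq_prod (Ioo 0 S)
  have hQ : ((slab E (Ioo 0 S) isOpen_Ioo : Opens (ℝ × E)) : Set (ℝ × E)) = Ioo 0 S ×ˢ univ := rfl
  have hum : AEStronglyMeasurable (fun z : ℝ × E => u z.1 z.2) μS := by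
    have h := hdist.1.aestronglyMeasurable
    rwa [hQ] at h
  have hPm : AEStronglyMeasurable (fun z : ℝ × E => P z.1 z.2) μS := by
    have h := hdist.2.2.1.aestronglyMeasurable
    rwa [hQ] at h
  -- `‖u‖³` is integrable on the slab
  have hU3 : Integrable (fun z : ℝ × E => ‖u z.1 z.2‖ ^ 3) μS := by
    have hmem : MemLp (fun z : ℝ × E => u z.1 z.2) 3 μS := by
      refine ⟨hum, ?_⟩
      rw [eLpNorm_eq_lintegral_rpow_enorm_toReal (by norm_num) (by norm_num)]
      simp only [ENNReal.toReal_ofNat, one_div]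
      refine ENNReal.rpow_lt_top_of_nonneg (by norm_num) (ne_of_lt ?_)
      have hmeas : AEMeasurable (fun z : ℝ × E => ‖u z.1 z.2‖ₑ ^ (3 : ℝ))
          ((volume.restrict (Ioo 0 S)).prod (volume : Measure E)) := by
        rw [← hμS']; exact hum.enorm.pow_const _
      rw [hμS', lintegral_prod _ hmeas]
      calc ∫⁻ τ in Ioo 0 S, ∫⁻ x, ‖u τ x‖ₑ ^ (3 : ℝ)
          ≤ ∫⁻ _ in Ioo 0 S, (M : ℝ≥0∞) ^ (3 : ℝ) := by
            refine lintegral_mono_ae ?_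
            filter_upwards [ae_restrict_mem measurableSet_Ioo] with τ hτ
            have e := eLpNorm_eq_lintegral_rpow_enorm_toReal (f := u τ) (p := 3) (μ := volume)
              (by norm_num) (by norm_num)
            simp only [ENNReal.toReal_ofNat, one_div] at e
            have h1 : (∫⁻ x, ‖u τ x‖ₑ ^ (3 : ℝ)) = eLpNorm (u τ) 3 volume ^ (3 : ℝ) := by
              rw [e, ← ENNReal.rpow_mul]; norm_num
            rw [h1]
            exact ENNReal.rpow_le_rpow (huM τ hτ) (by norm_num)
        _ < ⊤ := by
            rw [lintegral_const, Measure.restrict_apply_univ, Real.volume_Ioo]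
            exact ENNReal.mul_lt_top (ENNReal.rpow_lt_top_of_nonneg (by norm_num) ENNReal.coe_ne_top)
              ENNReal.ofReal_lt_top
    exact hmem.integrable_norm_pow three_ne_zero
  -- `|P|^{3/2}` is integrable on the slab
  have hP32 : Integrable (fun z : ℝ × E => |P z.1 z.2| ^ (3 / 2 : ℝ)) μS := by
    have h := hP.integrable_norm_rpow (by norm_num) three_halves_ne_top
    simpa only [toReal_three_halves, Real.norm_eq_abs, uncurry] using h
  -- `‖Ψ‖`, `‖DΨ‖` are integrable on the slab
  have hvol : volume (Ioo (0 : ℝ) S) < ⊤ := by rw [Real.volume_Ioo]; exact ENNReal.ofReal_lt_top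
  have hΨS : Integrable (fun z : ℝ × E => ‖Ψ z.1 z.2‖) μS := by
    refine ⟨(hΨc.norm).aestronglyMeasurable, ?_⟩
    have hmeas : AEMeasurable (fun z : ℝ × E => ‖‖Ψ z.1 z.2‖‖ₑ)
        ((volume.restrict (Ioo 0 S)).prod (volume : Measure E)) :=
      (hΨc.norm).measurable.enorm.aemeasurable
    rw [hasFiniteIntegral_iff_enorm, hμS', lintegral_prod _ hmeas]
    calc ∫⁻ τ in Ioo 0 S, ∫⁻ x, ‖‖Ψ τ x‖‖ₑ
        ≤ ∫⁻ _ in Ioo 0 S, ENNReal.ofReal (∫ x, ‖φ x‖) := by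
          refine lintegral_mono fun τ => ?_
          simp only [enorm_norm]
          rw [← ofReal_integral_norm_eq_lintegral_enorm (hΨint τ)]
          exact ENNReal.ofReal_le_ofReal (hΨL1 τ)
      _ < ⊤ := by
          rw [lintegral_const, Measure.restrict_apply_univ]
          exact ENNReal.mul_lt_top ENNReal.ofReal_lt_top hvol
  have hDΨS : Integrable (fun z : ℝ × E => ‖fderiv ℝ (Ψ z.1) z.2‖) μS := by
    refine ⟨(hDΨc.norm).aestronglyMeasurable, ?_⟩
    have hmeas : AEMeasurable (fun z : ℝ × E => ‖‖fderiv ℝ (Ψ z.1) z.2‖‖ₑ)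
        ((volume.restrict (Ioo 0 S)).prod (volume : Measure E)) :=
      (hDΨc.norm).measurable.enorm.aemeasurable
    rw [hasFiniteIntegral_iff_enorm, hμS', lintegral_prod _ hmeas]
    calc ∫⁻ τ in Ioo 0 S, ∫⁻ x, ‖‖fderiv ℝ (Ψ τ) x‖‖ₑ
        ≤ ∫⁻ _ in Ioo 0 S, ENNReal.ofReal (∫ x, ‖fderiv ℝ φ x‖) := by
          refine lintegral_mono fun τ => ?_
          simp only [enorm_norm]
          rw [← ofReal_integral_norm_eq_lintegral_enorm (hDΨint τ)]
          exact ENNReal.ofReal_le_ofReal (hDΨL1 τ)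
      _ < ⊤ := by
          rw [lintegral_const, Measure.restrict_apply_univ]
          exact ENNReal.mul_lt_top ENNReal.ofReal_lt_top hvol
  -- ### the integrands
  set A : ℝ × E → ℝ := fun z => ⟪u z.1 z.2, Ψ z.1 z.2⟫ with hA
  set N : ℝ × E → ℝ := fun z => ⟪u z.1 z.2, convect (u z.1) (Ψ z.1) z.2⟫ with hN
  set F : ℕ → ℝ × E → ℝ := fun n z =>
    deriv η z.1 * (cutoff ((n : ℝ) + 1) z.2 * A z) +
      η z.1 * (cutoff ((n : ℝ) + 1) z.2 * N z +
        fderiv ℝ (cutoff ((n : ℝ) + 1)) z.2 (u z.1 z.2) * A z +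
        ν * (2 * ∑ i, fderiv ℝ (cutoff ((n : ℝ) + 1)) z.2 (b i) *
          ⟪u z.1 z.2, fderiv ℝ (Ψ z.1) z.2 (b i)⟫ +
          (Δ (cutoff ((n : ℝ) + 1) : E → ℝ)) z.2 * A z) +
        P z.1 z.2 * fderiv ℝ (cutoff ((n : ℝ) + 1)) z.2 (Ψ z.1 z.2)) with hF
  set Fl : ℝ × E → ℝ := fun z => deriv η z.1 * A z + η z.1 * N z with hFl
  -- ### (i) the identity for each `n`
  have hident : ∀ n : ℕ, ∫ z, F n z ∂μS = 0 := by
    intro n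
    have hψ := isSpaceTimeTestOn_caloricCutoffTest hφ hν htS hη hηc hηt
      (contDiff_cutoff ((n : ℝ) + 1)) (hasCompactSupport_cutoff (hR n))
    have key := hdist.2.2.2.2 _ hψ
    rw [hQ] at key
    rw [← key]
    refine integral_congr_ae (Eventually.of_forall fun z => ?_)
    have e := veryWeakIntegrand_caloricCutoffTest hφ hdiv hν hη hηt (contDiff_cutoff ((n : ℝ) + 1))
      u P z.1 z.2
    simp only [Pi.zero_apply, inner_zero_left, add_zero]
    rw [e]
  -- ### (ii) measurability of the integrands
  have hχc : ∀ n : ℕ, Continuous (cutoff ((n : ℝ) + 1) : E → ℝ) := fun n =>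
    (contDiff_cutoff (n := 0) _).continuous
  have hDχc : ∀ n : ℕ, Continuous (fderiv ℝ (cutoff ((n : ℝ) + 1) : E → ℝ)) := fun n =>
    (contDiff_cutoff (n := 1) _).continuous_fderiv one_ne_zero
  have hΔχc : ∀ n : ℕ, Continuous (Δ (cutoff ((n : ℝ) + 1) : E → ℝ)) := fun n =>
    FluidPDE.continuous_laplacian (contDiff_cutoff (n := 2) _)
  have hAm : AEStronglyMeasurable A μS := hum.inner hΨc.aestronglyMeasurable
  have hNm : AEStronglyMeasurable N μS :=
    hum.inner (aestronglyMeasurable_clm_apply hDΨc.aestronglyMeasurable hum)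
  have hη1m : AEStronglyMeasurable (fun z : ℝ × E => η z.1) μS :=
    (hη.continuous.comp continuous_fst).aestronglyMeasurable
  have hdη1m : AEStronglyMeasurable (fun z : ℝ × E => deriv η z.1) μS :=
    (hηd.comp continuous_fst).aestronglyMeasurable
  have hFm : ∀ n, AEStronglyMeasurable (F n) μS := by
    intro n
    have m1 : AEStronglyMeasurable (fun z : ℝ × E => cutoff ((n : ℝ) + 1) z.2) μS :=
      ((hχc n).comp continuous_snd).aestronglyMeasurable
    have m2 : AEStronglyMeasurable (fun z : ℝ × E => fderiv ℝ (cutoff ((n : ℝ) + 1)) z.2) μS :=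
      ((hDχc n).comp continuous_snd).aestronglyMeasurable
    have m3 : AEStronglyMeasurable (fun z : ℝ × E => (Δ (cutoff ((n : ℝ) + 1) : E → ℝ)) z.2) μS :=
      ((hΔχc n).comp continuous_snd).aestronglyMeasurable
    have m4 : AEStronglyMeasurable (fun z : ℝ × E => fderiv ℝ (cutoff ((n : ℝ) + 1)) z.2 (u z.1 z.2)) μS :=
      aestronglyMeasurable_clm_apply m2 hum
    have m5 : ∀ i, AEStronglyMeasurable (fun z : ℝ × E =>
        fderiv ℝ (cutoff ((n : ℝ) + 1)) z.2 (b i) * ⟪u z.1 z.2, fderiv ℝ (Ψ z.1) z.2 (b i)⟫) μS :=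
      fun i => (m2.apply_continuousLinearMap (b i)).mul
        (hum.inner (hDΨc.aestronglyMeasurable.apply_continuousLinearMap (b i)))
    have m6 : AEStronglyMeasurable (fun z : ℝ × E =>
        ∑ i, fderiv ℝ (cutoff ((n : ℝ) + 1)) z.2 (b i) * ⟪u z.1 z.2, fderiv ℝ (Ψ z.1) z.2 (b i)⟫) μS := by
      exact Finset.aestronglyMeasurable_fun_sum _ fun i _ => m5 i
    have m7 : AEStronglyMeasurable (fun z : ℝ × E => fderiv ℝ (cutoff ((n : ℝ) + 1)) z.2 (Ψ z.1 z.2)) μS :=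
      aestronglyMeasurable_clm_apply m2 hΨc.aestronglyMeasurable
    exact (hdη1m.mul (m1.mul hAm)).add (hη1m.mul ((((m1.mul hNm).add (m4.mul hAm)).add
      (aestronglyMeasurable_const.mul ((aestronglyMeasurable_const.mul m6).add (m3.mul hAm)))).add
      (hPm.mul m7)))
  -- ### (iii) the dominating function
  set K₁ : ℝ := Md / 3 + Mη * (2 / 3 + 2 / 3 * C₁ + ν * (2 * (Fintype.card (Fin (Module.finrank ℝ E))) * C₁ / 3 + C₂ / 3))
    with hK₁
  set K₂ : ℝ := Mη * (2 / 3) with hK₂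
  set K₃ : ℝ := Md * (2 / 3 * Cs) + Mη * (1 / 3 * C₁ * Cs ^ 2 + ν * C₂ * (2 / 3 * Cs) + 1 / 3 * C₁ ^ 3 * Cs ^ 2)
    with hK₃
  set K₄ : ℝ := Mη * (1 / 3 * Cs ^ 2 + ν * 2 * (Fintype.card (Fin (Module.finrank ℝ E))) * C₁ * (2 / 3 * Cs))
    with hK₄
  set G : ℝ × E → ℝ := fun z => K₁ * ‖u z.1 z.2‖ ^ 3 + K₂ * |P z.1 z.2| ^ (3 / 2 : ℝ) +
    K₃ * ‖Ψ z.1 z.2‖ + K₄ * ‖fderiv ℝ (Ψ z.1) z.2‖ with hG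
  have hGi : Integrable G μS :=
    (((hU3.const_mul K₁).add (hP32.const_mul K₂)).add (hΨS.const_mul K₃)).add (hDΨS.const_mul K₄)
  -- the elementary estimates at a point
  have hptA : ∀ z : ℝ × E, |A z| ≤ ‖u z.1 z.2‖ ^ 3 / 3 + 2 / 3 * Cs * ‖Ψ z.1 z.2‖ := fun z =>
    (abs_real_inner_le_norm _ _).trans
      (mul_le_cube_add (norm_nonneg _) (norm_nonneg _) (hΨb _ _) hCs1)
  have hptN : ∀ z : ℝ × E, |N z| ≤ 2 / 3 * ‖u z.1 z.2‖ ^ 3 + 1 / 3 * Cs ^ 2 * ‖fderiv ℝ (Ψ z.1) z.2‖ := by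
    intro z
    calc |N z| ≤ ‖u z.1 z.2‖ * ‖fderiv ℝ (Ψ z.1) z.2 (u z.1 z.2)‖ := abs_real_inner_le_norm _ _
      _ ≤ ‖u z.1 z.2‖ * (‖fderiv ℝ (Ψ z.1) z.2‖ * ‖u z.1 z.2‖) :=
          mul_le_mul_of_nonneg_left (ContinuousLinearMap.le_opNorm _ _) (norm_nonneg _)
      _ = ‖u z.1 z.2‖ ^ 2 * ‖fderiv ℝ (Ψ z.1) z.2‖ := by ring
      _ ≤ 2 / 3 * ‖u z.1 z.2‖ ^ 3 + 1 / 3 * ‖fderiv ℝ (Ψ z.1) z.2‖ ^ 3 :=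
          sq_mul_le (norm_nonneg _) (norm_nonneg _)
      _ ≤ 2 / 3 * ‖u z.1 z.2‖ ^ 3 + 1 / 3 * (Cs ^ 2 * ‖fderiv ℝ (Ψ z.1) z.2‖) := by
          gcongr
          exact pow_three_le (norm_nonneg _) (hDΨb _ _)
      _ = _ := by ring
  have hbound : ∀ n z, ‖F n z‖ ≤ G z := by
    intro n z
    set a : ℝ := ‖u z.1 z.2‖ with ha
    set ps : ℝ := ‖Ψ z.1 z.2‖ with hps
    set d : ℝ := ‖fderiv ℝ (Ψ z.1) z.2‖ with hd
    have ha0 : 0 ≤ a := norm_nonneg _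
    have hps0 : 0 ≤ ps := norm_nonneg _
    have hd0 : 0 ≤ d := norm_nonneg _
    have b4 : |cutoff ((n : ℝ) + 1) z.2| ≤ 1 := abs_cutoff_le_one _ _
    have b5 : ‖fderiv ℝ (cutoff ((n : ℝ) + 1)) z.2‖ ≤ C₁ := hDχ n z.2
    have b6 : |(Δ (cutoff ((n : ℝ) + 1) : E → ℝ)) z.2| ≤ C₂ := hΔχ n z.2
    have hlin : ∀ v : E, |fderiv ℝ (cutoff ((n : ℝ) + 1)) z.2 v| ≤ C₁ * ‖v‖ := fun v => by
      rw [← Real.norm_eq_abs]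
      exact (ContinuousLinearMap.le_opNorm _ _).trans (mul_le_mul_of_nonneg_right b5 (norm_nonneg _))
    have hηz : |η z.1| ≤ Mη := by simpa [Real.norm_eq_abs] using hMη z.1
    have hdηz : |deriv η z.1| ≤ Md := by simpa [Real.norm_eq_abs] using hMd z.1
    -- AM–GM pieces
    have amA := hptA z
    have amN := hptN z
    have am1 : a ^ 2 * ps ≤ 2 / 3 * a ^ 3 + 1 / 3 * (Cs ^ 2 * ps) :=
      (sq_mul_le ha0 hps0).trans (by gcongr; exact pow_three_le hps0 (hΨb _ _))
    have am2 : a * d ≤ a ^ 3 / 3 + 2 / 3 * Cs * d := mul_le_cube_add ha0 hd0 (hDΨb _ _) hCs1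
    have am4 : |P z.1 z.2| * (C₁ * ps) ≤
        2 / 3 * |P z.1 z.2| ^ (3 / 2 : ℝ) + 1 / 3 * (C₁ ^ 3 * Cs ^ 2 * ps) := by
      refine (abs_mul_le_young (by positivity)).trans ?_
      gcongr
      have h1 : C₁ * ps ≤ C₁ * Cs := mul_le_mul_of_nonneg_left (hΨb _ _) hC₁0
      calc (C₁ * ps) ^ 3 ≤ (C₁ * Cs) ^ 2 * (C₁ * ps) := pow_three_le (by positivity) h1
        _ = C₁ ^ 3 * Cs ^ 2 * ps := by ring
    -- term by term
    have hT0 : |deriv η z.1 * (cutoff ((n : ℝ) + 1) z.2 * A z)| ≤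
        Md * (1 * (a ^ 3 / 3 + 2 / 3 * Cs * ps)) := by
      rw [abs_mul, abs_mul]
      exact mul_le_mul hdηz (mul_le_mul b4 amA (abs_nonneg _) zero_le_one) (by positivity) hMd0
    have hT1 : |cutoff ((n : ℝ) + 1) z.2 * N z| ≤ 1 * (2 / 3 * a ^ 3 + 1 / 3 * Cs ^ 2 * d) := by
      rw [abs_mul]
      exact mul_le_mul b4 amN (abs_nonneg _) zero_le_one
    have hT2 : |fderiv ℝ (cutoff ((n : ℝ) + 1)) z.2 (u z.1 z.2) * A z| ≤
        C₁ * (2 / 3 * a ^ 3 + 1 / 3 * (Cs ^ 2 * ps)) := by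
      rw [abs_mul]
      calc |fderiv ℝ (cutoff ((n : ℝ) + 1)) z.2 (u z.1 z.2)| * |A z|
          ≤ (C₁ * a) * (a * ps) :=
            mul_le_mul (hlin _) (abs_real_inner_le_norm _ _) (abs_nonneg _) (by positivity)
        _ = C₁ * (a ^ 2 * ps) := by ring
        _ ≤ C₁ * (2 / 3 * a ^ 3 + 1 / 3 * (Cs ^ 2 * ps)) := mul_le_mul_of_nonneg_left am1 hC₁0
    have e5 : ∀ i, |fderiv ℝ (cutoff ((n : ℝ) + 1)) z.2 (b i) *
        ⟪u z.1 z.2, fderiv ℝ (Ψ z.1) z.2 (b i)⟫| ≤ C₁ * (a * d) := fun i => by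
      rw [abs_mul]
      refine mul_le_mul ?_ ?_ (abs_nonneg _) hC₁0
      · simpa [b.orthonormal.1 i] using hlin (b i)
      · refine (abs_real_inner_le_norm _ _).trans (mul_le_mul_of_nonneg_left ?_ (norm_nonneg _))
        simpa [b.orthonormal.1 i] using ContinuousLinearMap.le_opNorm (fderiv ℝ (Ψ z.1) z.2) (b i)
    have e6 : |∑ i, fderiv ℝ (cutoff ((n : ℝ) + 1)) z.2 (b i) *
        ⟪u z.1 z.2, fderiv ℝ (Ψ z.1) z.2 (b i)⟫| ≤
        (Fintype.card (Fin (Module.finrank ℝ E))) * (C₁ * (a * d)) := by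
      refine (Finset.abs_sum_le_sum_abs _ _).trans ?_
      refine (Finset.sum_le_sum fun i _ => e5 i).trans ?_
      simp
    have e4 : |A z| ≤ a * ps := abs_real_inner_le_norm _ _
    have hT3 : |ν * (2 * ∑ i, fderiv ℝ (cutoff ((n : ℝ) + 1)) z.2 (b i) *
        ⟪u z.1 z.2, fderiv ℝ (Ψ z.1) z.2 (b i)⟫ +
        (Δ (cutoff ((n : ℝ) + 1) : E → ℝ)) z.2 * A z)| ≤
        ν * (2 * ((Fintype.card (Fin (Module.finrank ℝ E))) * (C₁ * (a ^ 3 / 3 + 2 / 3 * Cs * d))) +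
          C₂ * (a ^ 3 / 3 + 2 / 3 * Cs * ps)) := by
      rw [abs_mul, abs_of_pos hν]
      refine mul_le_mul_of_nonneg_left ((abs_add_le _ _).trans (add_le_add ?_ ?_)) hν.le
      · rw [abs_mul, abs_two]
        refine mul_le_mul_of_nonneg_left (e6.trans ?_) zero_le_two
        exact mul_le_mul_of_nonneg_left (mul_le_mul_of_nonneg_left am2 hC₁0) (by positivity)
      · rw [abs_mul]
        exact mul_le_mul b6 (e4.trans (mul_le_cube_add ha0 hps0 (hΨb _ _) hCs1)) (abs_nonneg _) hC₂0
    have hT4 : |P z.1 z.2 * fderiv ℝ (cutoff ((n : ℝ) + 1)) z.2 (Ψ z.1 z.2)| ≤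
        2 / 3 * |P z.1 z.2| ^ (3 / 2 : ℝ) + 1 / 3 * (C₁ ^ 3 * Cs ^ 2 * ps) := by
      rw [abs_mul]
      exact (mul_le_mul_of_nonneg_left (hlin _) (abs_nonneg _)).trans am4
    have hTη : |η z.1 * (cutoff ((n : ℝ) + 1) z.2 * N z +
        fderiv ℝ (cutoff ((n : ℝ) + 1)) z.2 (u z.1 z.2) * A z +
        ν * (2 * ∑ i, fderiv ℝ (cutoff ((n : ℝ) + 1)) z.2 (b i) *
          ⟪u z.1 z.2, fderiv ℝ (Ψ z.1) z.2 (b i)⟫ +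
          (Δ (cutoff ((n : ℝ) + 1) : E → ℝ)) z.2 * A z) +
        P z.1 z.2 * fderiv ℝ (cutoff ((n : ℝ) + 1)) z.2 (Ψ z.1 z.2))| ≤
        Mη * (1 * (2 / 3 * a ^ 3 + 1 / 3 * Cs ^ 2 * d) +
          C₁ * (2 / 3 * a ^ 3 + 1 / 3 * (Cs ^ 2 * ps)) +
          ν * (2 * ((Fintype.card (Fin (Module.finrank ℝ E))) * (C₁ * (a ^ 3 / 3 + 2 / 3 * Cs * d))) +
            C₂ * (a ^ 3 / 3 + 2 / 3 * Cs * ps)) +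
          (2 / 3 * |P z.1 z.2| ^ (3 / 2 : ℝ) + 1 / 3 * (C₁ ^ 3 * Cs ^ 2 * ps))) := by
      rw [abs_mul]
      refine mul_le_mul hηz ?_ (abs_nonneg _) hMη0
      exact (abs_add_le _ _).trans (add_le_add ((abs_add_le _ _).trans
        (add_le_add ((abs_add_le _ _).trans (add_le_add hT1 hT2)) hT3)) hT4)
    rw [Real.norm_eq_abs]
    calc |F n z| ≤ |deriv η z.1 * (cutoff ((n : ℝ) + 1) z.2 * A z)| +
          |η z.1 * (cutoff ((n : ℝ) + 1) z.2 * N z +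
            fderiv ℝ (cutoff ((n : ℝ) + 1)) z.2 (u z.1 z.2) * A z +
            ν * (2 * ∑ i, fderiv ℝ (cutoff ((n : ℝ) + 1)) z.2 (b i) *
              ⟪u z.1 z.2, fderiv ℝ (Ψ z.1) z.2 (b i)⟫ +
              (Δ (cutoff ((n : ℝ) + 1) : E → ℝ)) z.2 * A z) +
            P z.1 z.2 * fderiv ℝ (cutoff ((n : ℝ) + 1)) z.2 (Ψ z.1 z.2))| := abs_add_le _ _
      _ ≤ Md * (1 * (a ^ 3 / 3 + 2 / 3 * Cs * ps)) +
          Mη * (1 * (2 / 3 * a ^ 3 + 1 / 3 * Cs ^ 2 * d) +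
            C₁ * (2 / 3 * a ^ 3 + 1 / 3 * (Cs ^ 2 * ps)) +
            ν * (2 * ((Fintype.card (Fin (Module.finrank ℝ E))) * (C₁ * (a ^ 3 / 3 + 2 / 3 * Cs * d))) +
              C₂ * (a ^ 3 / 3 + 2 / 3 * Cs * ps)) +
            (2 / 3 * |P z.1 z.2| ^ (3 / 2 : ℝ) + 1 / 3 * (C₁ ^ 3 * Cs ^ 2 * ps))) :=
          add_le_add hT0 hTη
      _ = G z := by
          simp only [hG, hK₁, hK₂, hK₃, hK₄, ha, hps, hd]
          ring
  -- ### (iv) the pointwise limit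
  have hlim : ∀ z : ℝ × E, Tendsto (fun n => F n z) atTop (𝓝 (Fl z)) := by
    intro z
    refine tendsto_const_nhds.congr' ?_
    have hev : ∀ᶠ n : ℕ in atTop, ‖z.2‖ < (n : ℝ) + 1 := by
      filter_upwards [(tendsto_natCast_atTop_atTop (R := ℝ)).eventually_gt_atTop ‖z.2‖] with n hn
      exact hn.trans (lt_add_one _)
    filter_upwards [hev] with n hn
    have c1 : cutoff ((n : ℝ) + 1) z.2 = 1 := cutoff_eq_one (hR n) hn.le
    have c2 : fderiv ℝ (cutoff ((n : ℝ) + 1)) z.2 = 0 := fderiv_cutoff_eq_zero (hR n) hn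
    have c3 : (Δ (cutoff ((n : ℝ) + 1) : E → ℝ)) z.2 = 0 := laplacian_cutoff_eq_zero (hR n) hn
    simp [hF, hFl, c1, c2, c3]
  -- ### (v) dominated convergence on the slab: `∫ Fl = 0`
  have hFl0 : ∫ z, Fl z ∂μS = 0 := by
    have h := tendsto_integral_filter_of_dominated_convergence G (Eventually.of_forall hFm)
      (Eventually.of_forall fun n => Eventually.of_forall (hbound n)) hGi (Eventually.of_forall hlim)
    have h0 : Tendsto (fun n : ℕ => ∫ z, F n z ∂μS) atTop (𝓝 0) := by
      simp only [hident]; exact tendsto_const_nhds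
    exact tendsto_nhds_unique h h0
  -- ### (vi) Fubini
  have hFlb : ∀ z, ‖Fl z‖ ≤ G z := fun z =>
    le_of_tendsto' ((hlim z).norm) (fun n => hbound n z)
  have hFli : Integrable Fl μS :=
    Integrable.mono' hGi ((hdη1m.mul hAm).add (hη1m.mul hNm)) (Eventually.of_forall hFlb)
  -- ### (vi) Fubini and the slice integrals
  have hFli' : Integrable Fl ((volume.restrict (Ioo 0 S)).prod (volume : Measure E)) := by
    rw [← hμS']; exact hFli
  have hprod : ∫ τ in Ioo 0 S, ∫ x, Fl (τ, x) = 0 := by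
    rw [← integral_prod Fl hFli', ← hμS', hFl0]
  -- the slice pairings are honest integrals
  have iA : ∀ τ ∈ Ioo 0 S, Integrable (fun x => ⟪u τ x, Ψ τ x⟫) (volume : Measure E) := by
    intro τ hτ
    refine Integrable.mono' ((((hu3 τ hτ).integrable_norm_pow three_ne_zero).div_const 3).add
      ((hΨint τ).norm.const_mul (2 / 3 * Cs)))
      ((hu3 τ hτ).1.inner (hΨcs τ).aestronglyMeasurable) (Eventually.of_forall fun x => ?_)
    rw [Real.norm_eq_abs]
    exact hptA (τ, x)
  have iN : ∀ τ ∈ Ioo 0 S, Integrable (fun x => ⟪u τ x, convect (u τ) (Ψ τ) x⟫)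
      (volume : Measure E) := by
    intro τ hτ
    refine Integrable.mono' ((((hu3 τ hτ).integrable_norm_pow three_ne_zero).const_mul (2 / 3)).add
      ((hDΨint τ).norm.const_mul (1 / 3 * Cs ^ 2)))
      ((hu3 τ hτ).1.inner (aestronglyMeasurable_clm_apply (hDΨcs τ).aestronglyMeasurable
        (hu3 τ hτ).1)) (Eventually.of_forall fun x => ?_)
    rw [Real.norm_eq_abs]
    exact hptN (τ, x)
  have hslice : ∀ τ ∈ Ioo 0 S, ∫ x, Fl (τ, x) =
      (deriv η τ * ∫ x, ⟪u τ x, Ψ τ x⟫) + η τ * ∫ x, ⟪u τ x, convect (u τ) (Ψ τ) x⟫ := by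
    intro τ hτ
    simp only [hFl, hA, hN]
    rw [integral_add ((iA τ hτ).const_mul _) ((iN τ hτ).const_mul _), integral_const_mul,
      integral_const_mul]
  have hIooS : ∫ τ in Ioo 0 S, ((deriv η τ * ∫ x, ⟪u τ x, Ψ τ x⟫) +
      η τ * ∫ x, ⟪u τ x, convect (u τ) (Ψ τ) x⟫) = 0 := by
    have e : ∫ τ in Ioo 0 S, ((deriv η τ * ∫ x, ⟪u τ x, Ψ τ x⟫) +
        η τ * ∫ x, ⟪u τ x, convect (u τ) (Ψ τ) x⟫) = ∫ τ in Ioo 0 S, ∫ x, Fl (τ, x) :=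
      setIntegral_congr_fun measurableSet_Ioo fun τ hτ => (hslice τ hτ).symm
    rw [e]
    exact hprod
  -- ### (vii) the integrand vanishes off `tsupport η ⊆ (0, t) ⊆ (0, S)`
  have hvan : ∀ τ, τ ∉ tsupport η → ((deriv η τ * ∫ x, ⟪u τ x, Ψ τ x⟫) +
      η τ * ∫ x, ⟪u τ x, convect (u τ) (Ψ τ) x⟫) = 0 := fun τ hτ => by
    rw [hη0 τ hτ, hdη0 τ hτ]; ring
  have e1 : ∫ τ in Ioo 0 S, ((deriv η τ * ∫ x, ⟪u τ x, Ψ τ x⟫) +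
      η τ * ∫ x, ⟪u τ x, convect (u τ) (Ψ τ) x⟫) =
      ∫ τ, ((deriv η τ * ∫ x, ⟪u τ x, Ψ τ x⟫) + η τ * ∫ x, ⟪u τ x, convect (u τ) (Ψ τ) x⟫) :=
    setIntegral_eq_integral_of_forall_compl_eq_zero fun τ hτ =>
      hvan τ fun h => hτ ⟨(hηt h).1, (hηt h).2.trans htS⟩
  have e2 : ∫ τ in Ioo 0 t, ((deriv η τ * ∫ x, ⟪u τ x, Ψ τ x⟫) +
      η τ * ∫ x, ⟪u τ x, convect (u τ) (Ψ τ) x⟫) =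
      ∫ τ, ((deriv η τ * ∫ x, ⟪u τ x, Ψ τ x⟫) + η τ * ∫ x, ⟪u τ x, convect (u τ) (Ψ τ) x⟫) :=
    setIntegral_eq_integral_of_forall_compl_eq_zero fun τ hτ => hvan τ fun h => hτ (hηt h)
  show ∫ τ in Ioo 0 t, ((deriv η τ * ∫ x, ⟪u τ x, Ψ τ x⟫) +
      η τ * ∫ x, ⟪u τ x, convect (u τ) (Ψ τ) x⟫) = 0
  rw [e2, ← e1, hIooS]

end Core

/-! ### Continuity of the pairing and the main theorem -/

section Main

variable {E : Type*} [NormedAddCommGroup E] [InnerProductSpace ℝ E] [FiniteDimensional ℝ E]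
  [MeasurableSpace E] [BorelSpace E]

/-- From `‖v‖_{L³} ≤ M` to `∫ ‖v‖³ ≤ M³`. [folklore] -/
theorem integral_norm_pow_three_le' {v : E → E} (hv : MemLp v 3 volume) {M : ℝ≥0}
    (hM : eLpNorm v 3 volume ≤ M) : ∫ y, ‖v y‖ ^ 3 ≤ (M : ℝ) ^ 3 := by
  have h := hv.eLpNorm_eq_integral_rpow_norm (by norm_num) (by norm_num)
  have h3 : (3 : ℝ≥0∞).toReal = 3 := by norm_num
  rw [h3] at h
  have e : ∀ y, ‖v y‖ ^ (3 : ℝ) = ‖v y‖ ^ 3 := fun y => by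
    exact_mod_cast Real.rpow_natCast ‖v y‖ 3
  simp_rw [e] at h
  set I : ℝ := ∫ y, ‖v y‖ ^ 3 with hI
  have hI0 : 0 ≤ I := integral_nonneg fun y => by positivity
  rw [h] at hM
  have h1 : I ^ (3 : ℝ)⁻¹ ≤ (M : ℝ) := by
    have := (ENNReal.ofReal_le_iff_le_toReal ENNReal.coe_ne_top).1 hM
    simpa using this
  have h2 : (I ^ (3 : ℝ)⁻¹) ^ 3 = I := by
    have := Real.rpow_inv_natCast_pow hI0 (n := 3) three_ne_zero
    exact_mod_cast this
  calc I = (I ^ (3 : ℝ)⁻¹) ^ 3 := h2.symm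
    _ ≤ (M : ℝ) ^ 3 := pow_le_pow_left₀ (Real.rpow_nonneg hI0 _) h1 3

variable {ν : ℝ} {u : ℝ → E → E} {P : ℝ → E → ℝ} {φ : E → E}

/-- **Continuity of the caloric pairing.** For `u ∈ C((0,S); L³)`, a test field `φ`, `0 < ν`
and `t < S`, the pairing `g(τ) = ∫⟪u(τ), e^{ν(t−τ)Δ}φ⟫` is continuous on `(0, t]` from within
`(−∞, t]` (`|g(τ) − g(τ₀)| ≤ ‖u(τ) − u(τ₀)‖₃‖φ‖_{3/2} + ‖u(τ₀)‖₃ ‖Ψ(τ) − Ψ(τ₀)‖_{3/2}` and the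
`L^{3/2}`-Hölder continuity `eLpNorm_heatTest_sub_threeHalves_le`). [folklore] -/
theorem continuousWithinAt_pairing_heatTest {S t : ℝ} (hν : 0 < ν)
    (hφ : FunctionSpaces.IsTestFunctionOn (⊤ : Opens E) φ) (huc : ContinuousInLpOn (Ioo 0 S) 3 u)
    (htS : t < S) {τ₀ : ℝ} (hτ₀ : τ₀ ∈ Ioc 0 t) :
    ContinuousWithinAt (fun τ => ∫ x, ⟪u τ x, heatTest ν φ (t - τ) x⟫) (Iic t) τ₀ := by
  haveI : ENNReal.HolderTriple 3 (3 / 2) 1 := holderTriple_three_threeHalves_one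
  have hτ₀S : τ₀ ∈ Ioo 0 S := ⟨hτ₀.1, hτ₀.2.trans_lt htS⟩
  have hφc : HasCompactSupport φ := hφ.hasCompactSupport
  have hφcont : Continuous φ := hφ.contDiff.continuous
  have hφ32 : MemLp φ (3 / 2) volume := hφcont.memLp_of_hasCompactSupport hφc
  set Ψ : ℝ → E → E := fun σ => heatTest ν φ (t - σ) with hΨ
  have hΨq : ∀ σ, MemLp (Ψ σ) (3 / 2) volume := fun σ =>
    memLp_heatFlow_of_memLp hφ32 one_le_three_halves _
  have hΨle : ∀ σ, eLpNorm (Ψ σ) (3 / 2) volume ≤ eLpNorm φ (3 / 2) volume := fun σ =>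
    eLpNorm_heatFlow_le_of_memLp hφ32 one_le_three_halves _
  have h3 : ∀ τ ∈ Ioo 0 S, MemLp (u τ) 3 volume := huc.1
  -- the bound for `τ ∈ (0, S)`, `τ ≤ t`
  set K : ℝ≥0∞ := ENNReal.ofReal ν * eLpNorm (Δ φ) 2 volume with hK
  have hKtop : K ≠ ⊤ := ENNReal.mul_ne_top ENNReal.ofReal_ne_top
    ((FluidPDE.continuous_laplacian (contDiff_infty.1 hφ.contDiff 2)).memLp_of_hasCompactSupport
      (hφc.mono' fun x hx => by
        by_contra h
        exact hx (FluidPDE.laplacian_eq_zero_of_notMem_tsupport h))).2.ne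
  set L : ℝ≥0∞ := (2 * eLpNorm φ 1 volume) ^ (1 / 3 : ℝ) with hL
  have hLtop : L ≠ ⊤ := ENNReal.rpow_ne_top_of_nonneg (by norm_num)
    (ENNReal.mul_ne_top ENNReal.ofNat_ne_top (hφcont.memLp_of_hasCompactSupport hφc).2.ne)
  set B : ℝ → ℝ≥0∞ := fun τ =>
    eLpNorm (u τ - u τ₀) 3 volume * eLpNorm φ (3 / 2) volume +
      eLpNorm (u τ₀) 3 volume * (L * (ENNReal.ofReal |τ - τ₀| * K) ^ (2 / 3 : ℝ)) with hB
  have hdiff32 : ∀ τ, τ ≤ t → eLpNorm (Ψ τ - Ψ τ₀) (3 / 2) volume ≤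
      L * (ENNReal.ofReal |τ - τ₀| * K) ^ (2 / 3 : ℝ) := by
    intro τ hτ
    rcases le_total τ τ₀ with h | h
    · -- `σ₁ = τ ≤ σ₂ = τ₀ ≤ t`
      have key := eLpNorm_heatTest_sub_threeHalves_le hφ hν h hτ₀.2 (t := t)
      have e : Ψ τ - Ψ τ₀ = -(heatTest ν φ (t - τ₀) - heatTest ν φ (t - τ)) := by
        simp only [hΨ, neg_sub]
      rw [e, eLpNorm_neg, abs_of_nonpos (sub_nonpos.2 h), neg_sub]
      exact key
    · have key := eLpNorm_heatTest_sub_threeHalves_le hφ hν h hτ (t := t)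
      rw [abs_of_nonneg (sub_nonneg.2 h)]
      exact key
  have hbound : ∀ τ ∈ Ioo 0 S, τ ≤ t →
      ‖(∫ x, ⟪u τ x, Ψ τ x⟫) - ∫ x, ⟪u τ₀ x, Ψ τ₀ x⟫‖ₑ ≤ B τ := by
    intro τ hτ hτt
    have i1 : Integrable (fun x => ⟪u τ x, Ψ τ x⟫) volume :=
      integrable_inner_of_memLp_conj (h3 τ hτ) (hΨq τ)
    have i2 : Integrable (fun x => ⟪u τ₀ x, Ψ τ x⟫) volume :=
      integrable_inner_of_memLp_conj (h3 τ₀ hτ₀S) (hΨq τ)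
    have i3 : Integrable (fun x => ⟪u τ₀ x, Ψ τ₀ x⟫) volume :=
      integrable_inner_of_memLp_conj (h3 τ₀ hτ₀S) (hΨq τ₀)
    have e : (∫ x, ⟪u τ x, Ψ τ x⟫) - ∫ x, ⟪u τ₀ x, Ψ τ₀ x⟫ =
        (∫ x, ⟪(u τ - u τ₀) x, Ψ τ x⟫) + ∫ x, ⟪u τ₀ x, (Ψ τ - Ψ τ₀) x⟫ := by
      have s1 : ∫ x, ⟪(u τ - u τ₀) x, Ψ τ x⟫ = (∫ x, ⟪u τ x, Ψ τ x⟫) - ∫ x, ⟪u τ₀ x, Ψ τ x⟫ := by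
        rw [← integral_sub i1 i2]
        refine integral_congr_ae (Eventually.of_forall fun x => ?_)
        simp only [Pi.sub_apply, inner_sub_left]
      have s2 : ∫ x, ⟪u τ₀ x, (Ψ τ - Ψ τ₀) x⟫ =
          (∫ x, ⟪u τ₀ x, Ψ τ x⟫) - ∫ x, ⟪u τ₀ x, Ψ τ₀ x⟫ := by
        rw [← integral_sub i2 i3]
        refine integral_congr_ae (Eventually.of_forall fun x => ?_)
        simp only [Pi.sub_apply, inner_sub_right]
      rw [s1, s2]
      ring
    rw [e]
    have b1 := abs_integral_inner_le_eLpNorm_mul ((h3 τ hτ).sub (h3 τ₀ hτ₀S)) (hΨq τ)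
    have b2 := abs_integral_inner_le_eLpNorm_mul (h3 τ₀ hτ₀S) ((hΨq τ).sub (hΨq τ₀))
    have f1 : eLpNorm (u τ - u τ₀) 3 volume * eLpNorm (Ψ τ) (3 / 2) volume ≠ ⊤ :=
      ENNReal.mul_ne_top ((h3 τ hτ).sub (h3 τ₀ hτ₀S)).2.ne (hΨq τ).2.ne
    have f2 : eLpNorm (u τ₀) 3 volume * eLpNorm (Ψ τ - Ψ τ₀) (3 / 2) volume ≠ ⊤ :=
      ENNReal.mul_ne_top (h3 τ₀ hτ₀S).2.ne ((hΨq τ).sub (hΨq τ₀)).2.ne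
    calc ‖(∫ x, ⟪(u τ - u τ₀) x, Ψ τ x⟫) + ∫ x, ⟪u τ₀ x, (Ψ τ - Ψ τ₀) x⟫‖ₑ
        ≤ ‖∫ x, ⟪(u τ - u τ₀) x, Ψ τ x⟫‖ₑ + ‖∫ x, ⟪u τ₀ x, (Ψ τ - Ψ τ₀) x⟫‖ₑ := enorm_add_le _ _
      _ ≤ eLpNorm (u τ - u τ₀) 3 volume * eLpNorm (Ψ τ) (3 / 2) volume +
          eLpNorm (u τ₀) 3 volume * eLpNorm (Ψ τ - Ψ τ₀) (3 / 2) volume := by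
          refine add_le_add ?_ ?_
          · rw [Real.enorm_eq_ofReal_abs, ← ENNReal.ofReal_toReal f1]
            exact ENNReal.ofReal_le_ofReal b1
          · rw [Real.enorm_eq_ofReal_abs, ← ENNReal.ofReal_toReal f2]
            exact ENNReal.ofReal_le_ofReal b2
      _ ≤ B τ := by
          rw [hB]
          exact add_le_add (mul_le_mul' le_rfl (hΨle τ)) (mul_le_mul' le_rfl (hdiff32 τ hτt))
  -- `B τ → 0` as `τ → τ₀`
  have hB0 : Tendsto B (𝓝 τ₀) (𝓝 0) := by
    have t1 : Tendsto (fun τ => eLpNorm (u τ - u τ₀) 3 volume) (𝓝 τ₀) (𝓝 0) := by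
      have h := huc.2 τ₀ hτ₀S
      rwa [isOpen_Ioo.nhdsWithin_eq hτ₀S] at h
    have t1' : Tendsto (fun τ => eLpNorm (u τ - u τ₀) 3 volume * eLpNorm φ (3 / 2) volume) (𝓝 τ₀)
        (𝓝 0) := by
      have := ENNReal.Tendsto.mul_const t1 (Or.inr hφ32.2.ne)
      rwa [zero_mul] at this
    have t2 : Tendsto (fun τ : ℝ => ENNReal.ofReal |τ - τ₀|) (𝓝 τ₀) (𝓝 0) := by
      have h : Tendsto (fun τ : ℝ => |τ - τ₀|) (𝓝 τ₀) (𝓝 0) := by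
        have := ((continuous_id.sub continuous_const).abs.tendsto τ₀ : Tendsto
          (fun τ : ℝ => |τ - τ₀|) (𝓝 τ₀) (𝓝 |τ₀ - τ₀|))
        simpa using this
      have h' := (ENNReal.continuous_ofReal.tendsto 0).comp h
      rw [ENNReal.ofReal_zero] at h'
      exact h'
    have t3 : Tendsto (fun τ : ℝ => (ENNReal.ofReal |τ - τ₀| * K) ^ (2 / 3 : ℝ)) (𝓝 τ₀) (𝓝 0) := by
      have h1 : Tendsto (fun τ : ℝ => ENNReal.ofReal |τ - τ₀| * K) (𝓝 τ₀) (𝓝 0) := by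
        have := ENNReal.Tendsto.mul_const t2 (Or.inr hKtop)
        rwa [zero_mul] at this
      have h2 := ((ENNReal.continuous_rpow_const (y := (2 / 3 : ℝ))).tendsto 0).comp h1
      rwa [ENNReal.zero_rpow_of_pos (by norm_num)] at h2
    have t4 : Tendsto (fun τ : ℝ => eLpNorm (u τ₀) 3 volume *
        (L * (ENNReal.ofReal |τ - τ₀| * K) ^ (2 / 3 : ℝ))) (𝓝 τ₀) (𝓝 0) := by
      have h1 := ENNReal.Tendsto.const_mul t3 (Or.inr hLtop)
      rw [mul_zero] at h1
      have h2 := ENNReal.Tendsto.const_mul h1 (Or.inr (h3 τ₀ hτ₀S).2.ne)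
      rwa [mul_zero] at h2
    have := t1'.add t4
    rwa [add_zero] at this
  -- squeeze
  have hev : ∀ᶠ τ in 𝓝[Iic t] τ₀, ‖(∫ x, ⟪u τ x, Ψ τ x⟫) - ∫ x, ⟪u τ₀ x, Ψ τ₀ x⟫‖ₑ ≤ B τ := by
    have hmem : Ioo 0 S ∈ 𝓝[Iic t] τ₀ := mem_nhdsWithin_of_mem_nhds (isOpen_Ioo.mem_nhds hτ₀S)
    filter_upwards [hmem, self_mem_nhdsWithin] with τ hτ hτt
    exact hbound τ hτ hτt
  have hen : Tendsto (fun τ => ‖(∫ x, ⟪u τ x, Ψ τ x⟫) - ∫ x, ⟪u τ₀ x, Ψ τ₀ x⟫‖ₑ) (𝓝[Iic t] τ₀)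
      (𝓝 0) :=
    tendsto_of_tendsto_of_tendsto_of_le_of_le' tendsto_const_nhds (hB0.mono_left nhdsWithin_le_nhds)
      (Eventually.of_forall fun τ => bot_le) hev
  have hreal : Tendsto (fun τ => ‖(∫ x, ⟪u τ x, Ψ τ x⟫) - ∫ x, ⟪u τ₀ x, Ψ τ₀ x⟫‖) (𝓝[Iic t] τ₀)
      (𝓝 0) := by
    have h := (ENNReal.tendsto_toReal ENNReal.zero_ne_top).comp hen
    rw [ENNReal.toReal_zero] at h
    refine h.congr fun τ => ?_
    simp only [Function.comp_apply, toReal_enorm]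
  exact tendsto_iff_norm_sub_tendsto_zero.2 hreal

/-- **Distributional solutions with continuous `L³` slices are mild solutions**
(Fabes–Jones–Rivière 1972, Thm. 2.1, (i) ⇒ (ii); Lemarié-Rieusset 2016, Prop. 6.5 with Thm. 6.1:
very weak/Oseen solutions solve the integral equation). Let `(u, P)` be a distributional solution
of the unforced Navier–Stokes system with `ν > 0` on the open slab `(0, S) × E`
(`IsDistributionalNSSolutionOn`), with `u ∈ C((0,S); L³)`, `‖u(τ)‖_{L³} ≤ M` on `(0, S)` and
`P ∈ L^{3/2}((0,S) × E)`. Then for all `0 < s ≤ t < S` the two-time duality identity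
`∫⟪u(t), φ⟫ = ∫⟪u(s), e^{ν(t−s)Δ}φ⟫ + ∫ₛᵗ ∫⟪u, (u·∇)e^{ν(t−τ)Δ}φ⟫ dτ` holds for every smooth
compactly supported divergence-free `φ` (`IsMildNSSolutionBetween ν 0 u s t`). Proof: the tested
identity `integral_deriv_mul_pairing_add_eq_zero`, the du Bois-Reymond lemma
`exists_ae_eq_const_add_primitive`, and the continuity of the pairing
(`continuousWithinAt_pairing_heatTest`). [cite: FabesJonesRiviere1972, Thm. 2.1] -/
theorem isMildNSSolutionBetween_of_distributional {S : ℝ} {M : ℝ≥0} (hν : 0 < ν)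
    (hdist : IsDistributionalNSSolutionOn (slab E (Ioo 0 S) isOpen_Ioo) ν 0 u P)
    (huc : ContinuousInLpOn (Ioo 0 S) 3 u) (huM : ∀ τ ∈ Ioo 0 S, eLpNorm (u τ) 3 volume ≤ M)
    (hP : MemLp (uncurry P) (3 / 2) (volume.restrict (Ioo 0 S ×ˢ (univ : Set E))))
    {s t : ℝ} (hs : 0 < s) (hst : s ≤ t) (htS : t < S) :
    IsMildNSSolutionBetween ν 0 u s t := by
  rcases hst.eq_or_lt with h | hst'
  · subst h; exact IsMildNSSolutionBetween.refl ν 0 u s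
  intro φ hφ hdiv
  have ht : 0 < t := hs.trans hst'
  have hS : 0 < S := ht.trans htS
  have h3 : ∀ τ ∈ Ioo 0 S, MemLp (u τ) 3 volume := huc.1
  -- the test field
  have hφi : ContDiff ℝ ∞ φ := hφ.contDiff
  have hφ2 : ContDiff ℝ 2 φ := contDiff_infty.1 hφi 2
  have hφ1 : ContDiff ℝ 1 φ := contDiff_infty.1 hφi 1
  have hφc : HasCompactSupport φ := hφ.hasCompactSupport
  have hφc' : Continuous φ := hφi.continuous
  obtain ⟨Cφ, hCφ⟩ := hφc'.bounded_above_of_compact_support hφc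
  have hDφc : Continuous (fderiv ℝ φ) := hφ1.continuous_fderiv one_ne_zero
  have hDφs : HasCompactSupport (fderiv ℝ φ) := hφc.fderiv ℝ
  obtain ⟨CD, hCD⟩ := hDφc.bounded_above_of_compact_support hDφs
  have hφint : Integrable φ (volume : Measure E) := hφc'.integrable_of_hasCompactSupport hφc
  have hDφint : Integrable (fderiv ℝ φ) (volume : Measure E) :=
    hDφc.integrable_of_hasCompactSupport hDφs
  set Ψ : ℝ → E → E := fun τ => heatTest ν φ (t - τ) with hΨ
  have hΨsm : ∀ τ, ContDiff ℝ 2 (Ψ τ) := fun τ => contDiff_heatFlow hφ2 hφc _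
  have hΨcs : ∀ τ, Continuous (Ψ τ) := fun τ => (hΨsm τ).continuous
  have hDΨ : ∀ τ x, fderiv ℝ (Ψ τ) x = heatFlow (fderiv ℝ φ) (ν * (t - τ)) x := fun τ x =>
    fderiv_heatFlow hφ1 hφc _ x
  have hΨc : Continuous (uncurry Ψ) := continuous_uncurry_heatTest_sub hφc' hCφ ν t
  have hDΨc : Continuous fun q : ℝ × E => fderiv ℝ (Ψ q.1) q.2 := by
    simp only [hDΨ]
    exact continuous_uncurry_heatTest_sub hDφc hCD ν t
  have hDΨcs : ∀ τ, Continuous fun x => fderiv ℝ (Ψ τ) x := fun τ =>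
    hDΨc.comp (Continuous.prodMk_right τ)
  have hΨint : ∀ τ, Integrable (Ψ τ) (volume : Measure E) := fun τ => integrable_heatFlow hφint _
  have hDΨint : ∀ τ, Integrable (fun x => fderiv ℝ (Ψ τ) x) (volume : Measure E) := fun τ => by
    simp only [hDΨ]
    exact integrable_heatFlow hDφint _
  have hΨL1 : ∀ τ, ∫ x, ‖Ψ τ x‖ ≤ ∫ x, ‖φ x‖ := fun τ => integral_norm_heatFlow_le hφint _
  have hDΨL1 : ∀ τ, ∫ x, ‖fderiv ℝ (Ψ τ) x‖ ≤ ∫ x, ‖fderiv ℝ φ x‖ := fun τ => by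
    simp only [hDΨ]
    exact integral_norm_heatFlow_le hDφint _
  set Cs : ℝ := max 1 (max Cφ CD) with hCs
  have hCs1 : 1 ≤ Cs := le_max_left _ _
  have hCs0 : 0 ≤ Cs := zero_le_one.trans hCs1
  have hΨb : ∀ τ x, ‖Ψ τ x‖ ≤ Cs := fun τ x =>
    (norm_heatFlow_le hCφ _ x).trans ((le_max_left _ _).trans (le_max_right _ _))
  have hDΨb : ∀ τ x, ‖fderiv ℝ (Ψ τ) x‖ ≤ Cs := fun τ x => by
    rw [hDΨ]
    exact (norm_heatFlow_le hCD _ x).trans ((le_max_right _ _).trans (le_max_right _ _))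
  -- the two slice functionals
  set g : ℝ → ℝ := fun τ => ∫ x, ⟪u τ x, Ψ τ x⟫ with hg
  set Nf : ℝ → ℝ := fun τ => ∫ x, ⟪u τ x, convect (u τ) (Ψ τ) x⟫ with hNf
  -- ### bounds and measurability of `g`, `Nf` on `(0, S)`
  have hgb : ∀ τ ∈ Ioo 0 S, ‖g τ‖ ≤ (M : ℝ) ^ 3 / 3 + 2 / 3 * Cs * ∫ x, ‖φ x‖ := by
    intro τ hτ
    have i1 : Integrable (fun x => ‖u τ x‖ ^ 3) volume := (h3 τ hτ).integrable_norm_pow three_ne_zero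
    rw [Real.norm_eq_abs]
    calc |g τ| ≤ ∫ x, ‖⟪u τ x, Ψ τ x⟫‖ := by
          rw [hg, ← Real.norm_eq_abs]; exact norm_integral_le_integral_norm _
      _ ≤ ∫ x, (‖u τ x‖ ^ 3 / 3 + 2 / 3 * Cs * ‖Ψ τ x‖) := by
          refine integral_mono_of_nonneg (Eventually.of_forall fun x => norm_nonneg _)
            ((i1.div_const 3).add ((hΨint τ).norm.const_mul _)) (Eventually.of_forall fun x => ?_)
          dsimp only
          rw [Real.norm_eq_abs]
          exact (abs_real_inner_le_norm _ _).trans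
            (mul_le_cube_add (norm_nonneg _) (norm_nonneg _) (hΨb τ x) hCs1)
      _ = (∫ x, ‖u τ x‖ ^ 3) / 3 + 2 / 3 * Cs * ∫ x, ‖Ψ τ x‖ := by
          rw [integral_add (i1.div_const 3) ((hΨint τ).norm.const_mul _), integral_div,
            integral_const_mul]
      _ ≤ (M : ℝ) ^ 3 / 3 + 2 / 3 * Cs * ∫ x, ‖φ x‖ := by
          have h1 := integral_norm_pow_three_le' (h3 τ hτ) (huM τ hτ)
          have h2 := mul_le_mul_of_nonneg_left (hΨL1 τ) (by positivity : (0 : ℝ) ≤ 2 / 3 * Cs)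
          linarith
  have hNb : ∀ τ ∈ Ioo 0 S, ‖Nf τ‖ ≤ 2 / 3 * (M : ℝ) ^ 3 + 1 / 3 * Cs ^ 2 * ∫ x, ‖fderiv ℝ φ x‖ := by
    intro τ hτ
    have i1 : Integrable (fun x => ‖u τ x‖ ^ 3) volume := (h3 τ hτ).integrable_norm_pow three_ne_zero
    rw [Real.norm_eq_abs]
    calc |Nf τ| ≤ ∫ x, ‖⟪u τ x, convect (u τ) (Ψ τ) x⟫‖ := by
          rw [hNf, ← Real.norm_eq_abs]; exact norm_integral_le_integral_norm _
      _ ≤ ∫ x, (2 / 3 * ‖u τ x‖ ^ 3 + 1 / 3 * Cs ^ 2 * ‖fderiv ℝ (Ψ τ) x‖) := by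
          refine integral_mono_of_nonneg (Eventually.of_forall fun x => norm_nonneg _)
            ((i1.const_mul _).add ((hDΨint τ).norm.const_mul _)) (Eventually.of_forall fun x => ?_)
          dsimp only
          rw [Real.norm_eq_abs]
          calc |⟪u τ x, convect (u τ) (Ψ τ) x⟫| ≤ ‖u τ x‖ * ‖fderiv ℝ (Ψ τ) x (u τ x)‖ :=
                abs_real_inner_le_norm _ _
            _ ≤ ‖u τ x‖ * (‖fderiv ℝ (Ψ τ) x‖ * ‖u τ x‖) :=
                mul_le_mul_of_nonneg_left (ContinuousLinearMap.le_opNorm _ _) (norm_nonneg _)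
            _ = ‖u τ x‖ ^ 2 * ‖fderiv ℝ (Ψ τ) x‖ := by ring
            _ ≤ 2 / 3 * ‖u τ x‖ ^ 3 + 1 / 3 * ‖fderiv ℝ (Ψ τ) x‖ ^ 3 :=
                sq_mul_le (norm_nonneg _) (norm_nonneg _)
            _ ≤ 2 / 3 * ‖u τ x‖ ^ 3 + 1 / 3 * (Cs ^ 2 * ‖fderiv ℝ (Ψ τ) x‖) := by
                gcongr; exact pow_three_le (norm_nonneg _) (hDΨb τ x)
            _ = _ := by ring
      _ = 2 / 3 * (∫ x, ‖u τ x‖ ^ 3) + 1 / 3 * Cs ^ 2 * ∫ x, ‖fderiv ℝ (Ψ τ) x‖ := by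
          rw [integral_add (i1.const_mul _) ((hDΨint τ).norm.const_mul _), integral_const_mul,
            integral_const_mul]
      _ ≤ 2 / 3 * (M : ℝ) ^ 3 + 1 / 3 * Cs ^ 2 * ∫ x, ‖fderiv ℝ φ x‖ := by
          have h1 := integral_norm_pow_three_le' (h3 τ hτ) (huM τ hτ)
          have h2 := mul_le_mul_of_nonneg_left (hDΨL1 τ) (by positivity : (0 : ℝ) ≤ 1 / 3 * Cs ^ 2)
          linarith
  -- measurability through the slab
  have hQ : ((slab E (Ioo 0 S) isOpen_Ioo : Opens (ℝ × E)) : Set (ℝ × E)) = Ioo 0 S ×ˢ univ := rfl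
  have hum : AEStronglyMeasurable (fun z : ℝ × E => u z.1 z.2)
      ((volume.restrict (Ioo 0 S)).prod (volume : Measure E)) := by
    have h := hdist.1.aestronglyMeasurable
    rw [hQ, volume_restrict_prod_univ_eq_prod] at h
    exact h
  have hgm : AEStronglyMeasurable g (volume.restrict (Ioo 0 S)) := by
    have hA : AEStronglyMeasurable (fun z : ℝ × E => ⟪u z.1 z.2, Ψ z.1 z.2⟫)
        ((volume.restrict (Ioo 0 S)).prod (volume : Measure E)) := hum.inner hΨc.aestronglyMeasurable
    exact hA.integral_prod_right'
  have hNm : AEStronglyMeasurable Nf (volume.restrict (Ioo 0 S)) := by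
    have hA : AEStronglyMeasurable (fun z : ℝ × E => ⟪u z.1 z.2, convect (u z.1) (Ψ z.1) z.2⟫)
        ((volume.restrict (Ioo 0 S)).prod (volume : Measure E)) :=
      hum.inner (aestronglyMeasurable_clm_apply hDΨc.aestronglyMeasurable hum)
    exact hA.integral_prod_right'
  have hsub : Ioo 0 t ⊆ Ioo 0 S := Ioo_subset_Ioo le_rfl htS.le
  have hvol_t : volume (Ioo (0 : ℝ) t) < ⊤ := by rw [Real.volume_Ioo]; exact ENNReal.ofReal_lt_top
  have hgi : IntegrableOn g (Ioo 0 t) := by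
    refine IntegrableOn.of_bound hvol_t (hgm.mono_measure (Measure.restrict_mono hsub le_rfl))
      ((M : ℝ) ^ 3 / 3 + 2 / 3 * Cs * ∫ x, ‖φ x‖) ?_
    filter_upwards [ae_restrict_mem measurableSet_Ioo] with τ hτ
    exact hgb τ (hsub hτ)
  have hNi : IntegrableOn Nf (Ioo 0 t) := by
    refine IntegrableOn.of_bound hvol_t (hNm.mono_measure (Measure.restrict_mono hsub le_rfl))
      (2 / 3 * (M : ℝ) ^ 3 + 1 / 3 * Cs ^ 2 * ∫ x, ‖fderiv ℝ φ x‖) ?_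
    filter_upwards [ae_restrict_mem measurableSet_Ioo] with τ hτ
    exact hNb τ (hsub hτ)
  -- ### du Bois-Reymond
  obtain ⟨c, hc⟩ := exists_ae_eq_const_add_primitive hgi hNi fun χ hχ hχc hχt =>
    integral_deriv_mul_pairing_add_eq_zero hν hdist h3 huM hP hφ hdiv ht htS hχ hχc hχt
  set G : ℝ → ℝ := fun τ => c + ∫ σ in Ioc 0 τ, Nf σ with hG
  have hNi' : IntegrableOn Nf (Icc 0 t) :=
    (integrableOn_Icc_iff_integrableOn_Ioo (by simp) (by simp)).2 hNi
  have hGc : ContinuousOn G (Icc 0 t) :=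
    continuousOn_const.add (intervalIntegral.continuousOn_primitive hNi')
  -- continuity of `g` on `(0, t]`
  have hgc : ∀ τ₀ ∈ Ioc 0 t, ContinuousWithinAt g (Iic t) τ₀ := fun τ₀ hτ₀ =>
    continuousWithinAt_pairing_heatTest hν hφ huc htS hτ₀
  have hgc' : ContinuousOn g (Ioo 0 t) := fun τ₀ hτ₀ =>
    (hgc τ₀ ⟨hτ₀.1, hτ₀.2.le⟩).mono fun x hx => le_of_lt hx.2
  -- `g = G` on `(0, t)`
  have heq : EqOn g G (Ioo 0 t) :=
    Measure.eqOn_open_of_ae_eq hc isOpen_Ioo hgc' (hGc.mono Ioo_subset_Icc_self)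
  -- and at `t`, by continuity from the left
  haveI : (𝓝[Ioo 0 t] t).NeBot := right_nhdsWithin_Ioo_neBot ht
  have hgt : g t = G t := by
    have h1 : Tendsto g (𝓝[Ioo 0 t] t) (𝓝 (g t)) :=
      (hgc t ⟨ht, le_rfl⟩).mono_left (nhdsWithin_mono _ fun x hx => le_of_lt hx.2)
    have h2 : Tendsto G (𝓝[Ioo 0 t] t) (𝓝 (G t)) :=
      (hGc t ⟨ht.le, le_rfl⟩).mono_left (nhdsWithin_mono _ Ioo_subset_Icc_self)
    have h3' : Tendsto g (𝓝[Ioo 0 t] t) (𝓝 (G t)) :=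
      h2.congr' (eventually_nhdsWithin_of_forall fun τ hτ => (heq hτ).symm)
    exact tendsto_nhds_unique h1 h3'
  have hgs : g s = G s := heq ⟨hs, hst'⟩
  -- ### the identity
  have hNint : IntervalIntegrable Nf volume 0 t :=
    (intervalIntegrable_iff_integrableOn_Icc_of_le ht.le).2 hNi'
  have hNint_s : IntervalIntegrable Nf volume 0 s :=
    hNint.mono_set (by rw [uIcc_of_le hs.le, uIcc_of_le ht.le]; exact Icc_subset_Icc le_rfl hst)
  have hdiff : g t - g s = ∫ τ in s..t, Nf τ := by
    rw [hgt, hgs, hG]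
    dsimp only
    rw [← intervalIntegral.integral_of_le ht.le, ← intervalIntegral.integral_of_le hs.le,
      add_sub_add_left_eq_sub, intervalIntegral.integral_interval_sub_left hNint hNint_s]
  have hgt' : g t = ∫ x, ⟪u t x, φ x⟫ := by
    simp only [hg, hΨ, sub_self, heatTest_zero_right]
  have hgs' : g s = ∫ x, ⟪u s x, heatTest ν φ (t - s) x⟫ := rfl
  show ∫ x, ⟪u t x, φ x⟫ = (∫ x, ⟪u s x, heatTest ν φ (t - s) x⟫) +
    (∫ τ in s..t, ∫ x, ⟪u τ x, convect (u τ) (heatTest ν φ (t - τ)) x⟫) +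
    ∫ τ in s..t, ∫ x, ⟪(0 : ℝ → E → E) τ x, heatTest ν φ (t - τ) x⟫
  simp only [Pi.zero_apply, inner_zero_left, integral_zero, intervalIntegral.integral_zero, add_zero]
  rw [← hgt', ← hgs']
  have : (∫ τ in s..t, ∫ x, ⟪u τ x, convect (u τ) (heatTest ν φ (t - τ)) x⟫) = ∫ τ in s..t, Nf τ := rfl
  rw [this, ← hdiff]
  ring

/-- **The translate of a distributional `C_t L³` solution is a mild solution from its slice**:
under the hypotheses of `isMildNSSolutionBetween_of_distributional`, for `s ∈ (0, S)` the field
`σ ↦ u(σ + s)` is a mild solution on `[0, S − s)` with datum `u(s)` in the accepted duality form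
(`IsMildNSSolutionOn (Ico 0 (S − s)) ν 0 (u s) (fun σ => u (σ + s))`), given the weak
divergence-freeness of the slices. [cite: FabesJonesRiviere1972, Thm. 2.1] -/
theorem isMildNSSolutionOn_translate_of_distributional {S : ℝ} {M : ℝ≥0} (hν : 0 < ν)
    (hdist : IsDistributionalNSSolutionOn (slab E (Ioo 0 S) isOpen_Ioo) ν 0 u P)
    (huc : ContinuousInLpOn (Ioo 0 S) 3 u) (huM : ∀ τ ∈ Ioo 0 S, eLpNorm (u τ) 3 volume ≤ M)
    (hP : MemLp (uncurry P) (3 / 2) (volume.restrict (Ioo 0 S ×ˢ (univ : Set E))))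
    (hdiv : ∀ τ ∈ Ioo 0 S, IsWeaklyDivFree (u τ)) {s : ℝ} (hs : s ∈ Ioo 0 S) :
    IsMildNSSolutionOn (Ico 0 (S - s)) ν 0 (u s) (fun σ => u (σ + s)) := by
  refine ⟨fun σ hσ => hdiv (σ + s) ⟨by linarith [hσ.1, hs.1], by linarith [hσ.2]⟩,
    fun σ hσ => ?_⟩
  have hb' : IsMildNSSolutionBetween ν 0 u s (σ + s) :=
    isMildNSSolutionBetween_of_distributional hν hdist huc huM hP hs.1 (by linarith [hσ.1])
      (by linarith [hσ.2])
  have hb : IsMildNSSolutionBetween ν 0 u (0 + s) (σ + s) := by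
    simp only [zero_add]
    exact hb'
  have h2 : IsMildNSSolutionBetween ν 0 (fun τ => u (τ + s)) 0 σ :=
    IsMildNSSolutionBetween.comp_add_right_zero hb
  have h3 : IsMildNSSolutionFrom ν 0 ((fun τ => u (τ + s)) 0) (fun τ => u (τ + s)) σ :=
    isMildNSSolutionFrom_self_iff.2 h2
  simpa only [zero_add] using h3

end Main

end DistributionalL3Mild

end Literature.Analysis.FluidPDE

end
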